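/-
Copyright: lit-balaban Phase-2 proof seat p29 (gen 30).  Statement-level skeleton of a published paper; no proof claims beyond what the
kernel checks below.
-/
import Literature.MathematicalPhysics.QuantumFieldTheory.BalabanImbrieJaffe1984to88.BIJ88LocHolder231TorusOfInputs

/-!
# `BalabanImbrieJaffe1984to88.BIJ88Loc231RegionOfInputs` — T. Bałaban, J. Imbrie, A. Jaffe, *Effective action and cluster properties of the
abelian Higgs model*, Commun. Math. Phys. **114** (1988) 257–315 [BalabanImbrieJaffe1988], Sect. 2 p. 263 [PDF 7], (2.31) and the sentence
after (2.33) — **THE COVARIANT-DERIVATIVE, VALUE AND HÖLDER-`θ ≤ 1` MEMBERS OF (2.31) FOR A GENERAL REGION `Ω ⊇ Ω₀`, FOR THE PRINTED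
LOCALIZATION DATA OF RECORD, AT AN ARBITRARY `U(1)` FIELD `u`, FROM THE FOUR [6]-INPUTS AS HYPOTHESES**: this gen's
`BIJ88LocDeriv231TorusOfInputs.deriv231_wholeTorus_of_inputs` and `BIJ88LocHolder231TorusOfInputs.{close231, holder231,
exists_contour_holder231}_wholeTorus_of_inputs` — the case `Ω = T^{(0)}` — with the comparison propagator `G_k(T_η,u)` replaced by the
Neumann propagator `G_k(Ω,u) = gBox A ε⁻¹ u k Ω` of an ARBITRARY finite region `Ω` of the fine torus containing the reference box `Ω₀` that
carries the data (print: *"for (2.31) we assume smoothness throughout the subset Ω ⊂ T_η"*, *"(2.31) for dist(x, Ω^c) ≧ O(r(e_k))"*).  The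
other extreme `Ω = Ω₀` is gen 27's `BIJ88LocDeriv231FlatTorus.deriv231_flat_cwt` (flat `u`); every `Ω` in between is covered here.

statement-level skeleton of published theorems with citation tags; proofs where landed; nothing here is a claim about the Yang–Mills mass gap

PDF held: `paper:balaban1988-cmp114-bij-abelian-higgs-effective-action` (journal page = PDF page + 256); p. 263 [PDF 7] re-read this session.

CITATION HEADER (lean-in-tree rule).  Part of the lit-balaban TYPED SKELETON (HOME `run/shared/lean/pub/lit-balaban/`), PHASE-2 proof seat
p29 gen 30 (unit `lit-balaban-p29-g30`; TAKING #5 line HOME/STATUS.md 2026-08-23T07:56Z — own lineage; disjoint from r18 gen 25's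
`BIJ88Close231RegularRegionCwt` / `BIJ88LocDerivHolder231RegularRegion` (regular `u`, big-block cubes, hypothesis-free; there the region must
contain the big-block hull of `Ω₀`); free-target protocol G.5-34(d)).  Rows **C2.Eq2.31** / **C2.Claim@263** (owner r18; heads unchanged —
LOCATED, HYPOTHESIS-FORM members).  Kind: theorems only (no definition, no `Prop`-valued fact; declarations of gens 26–30, r18, p31, T4 BY NAME).

THE PRINTED TEXT (p. 263, verbatim, print order).  *"|(G_{k,loc}(u)f − G_k(Ω,u)f)(x)| ≦ e^{−cr(e_k)}e^{−c dist(suppt f,x)}‖f‖_∞, (2.31) for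
dist(x, Ω^c) ≧ O(r(e_k)). [Each G_k(□_α,u) is close to G_k(Ω,u) for the relevant x₁, x₂, therefore the convex combination and G_{k,loc} are close
also.] We assume that u is smooth in the □_α's entering the sum in (2.27); for (2.31) we assume smoothness throughout the subset Ω ⊂ T_η. …
Bounds analogous to (2.30), (2.31) hold for covariant derivatives and Hölder derivatives of G_{k,loc}(u) of order less than two."*

THE MECHANISM (declared; = the `Ω = T^{(0)}` files verbatim).  gen 27's bond identity `covD_gLocT_sub_apply` holds for ANY comparison matrix
`G₀`; with `G₀ = G_k(Ω,u)`: TERM 1 ← (H1) the (1.11)–(1.12) covariant-derivative closeness `G_k(□,u)` vs `G_k(Ω,u)` for the fitting cubes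
`□ ⊆ Ω` (the cubes active at a deep row lie in `Ω₀ ⊆ Ω`: gen 26's `cubeOf_subset`; their geometry against `T ∖ □`: r18's `rowHyp_ii_torus`);
TERM 2 ← (H2) the value closeness; TERMS 3–4 ← (H3)/(H4) the (1.10) members of `G_k(Ω,u)` at the row `x`, which is `ρ`-deep in `Ω` because it
is `(R₀ + R)`-deep in the chart of `Ω₀ ⊆ Ω` (r18's `lt_T_of_not_mem`).  §2 = p31's `opClose231_gen` with its region slot `Ω` and `X₀ = {x}`;
§3 = this gen's kernel `weighted_transport_sub_le` with §1 on the bonds of the contour and §2 at its end points; §4 = gen 28's chart staircase.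

WHAT IS PROVED (theorems only; 0 `sorry`; standard axioms).  In all four: `∀ Ω : Finset`, datum `Ω₀ ⊆ Ω`; (H1)/(H2) carry the premise
`□ ⊆ Ω`; (H3)/(H4) are asked at the rows `x ∈ Ω` with `|x − w|_T ≥ ρ` for all `w ∉ Ω` only (`G_k(Ω,u)` has no `k`-uniform covariant-derivative
bound across `∂Ω`); otherwise the statements and constants are those of the `Ω = T^{(0)}` members.
* §1 **`deriv231_region_of_inputs`** — `‖D_u(G_{k,loc}(u)f)(x,μ) − D_u(G_k(Ω,u)f)(x,μ)‖ ≤ (L^kε)·C·[m(1 + L^k((R₀−R₁)⁻¹ + s⁻¹))e^{−δ₀(2R−1)/L^k} +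
  (1 + L^k(R₀−R₁)⁻¹)e^{−(δ₀/2)(R₁−1)/L^k}]·e^{−(δ₀/2)D/L^k}·F` at every bond with both ends in `Ω₀` at chart depth `≥ R₀ + R`, `R > ρ + 1`.
* §2 **`close231_region_of_inputs`** — `|(G_{k,loc}(u)f − G_k(Ω,u)f)(x)| ≤ (L^kε)²·c₀·[m·e^{−2δ₀R/L^k} + e^{−(δ₀/2)R₁/L^k}]·e^{−(δ₀/2)D/L^k}·F` at
  every `x ∈ Ω₀` at chart depth `≥ R₀ + R`, `R ≥ ρ`, from (H2), (H4).
* §3 **`holder231_region_of_inputs`** — `(L^k/|x₁ − x₂|_T)^θ·‖u(Γ)ψ(x₂) − ψ(x₁)‖ ≤ (L^kε)²·C·e^{δ₀/2}·[bracket of §1]·e^{−(δ₀/2)D/L^k}·F`,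
  `ψ = G_{k,loc}(u)f − G_k(Ω,u)f`, `0 ≤ θ ≤ 1`, along admissible contours; §4 **`exists_contour_holder231_region_of_inputs`** (chart staircase).
HONEST SCOPE / DIVERGENCE.  (i) HYPOTHESIS FORM (providers of record: flat — r01/r18/p31; (2.23)-regular — r01/r18 (`…RegularRegionCwt`);
small plaquette — p30's `close112_smallField[_deriv]_of_inputs` (any block unions `□ ⊆ Ω`), p34's/p27's region members
`decay110_smallPlaquette_region[_deep]_uniform`, `BIJ88NeumannPropagatorSmallFieldRegionDeriv`; an instance is not part of this file).  (ii) The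
region enters ONLY through the comparison propagator and the inputs; the data (cubes, weights, cut-off) live in `Ω₀ ⊆ Ω` as in every member of
the lane (print's family covers `Ω`; see the `Ω = T^{(0)}` files, HONEST SCOPE (ii)).  (iii) Deep bonds/rows only (chart depth `≥ R₀ + R` in
`Ω₀`, hence `≥ R₀ + R` from `T ∖ Ω`).  (iv) p13's Lipschitz cut-off `cutoff R₁ R₀ |·|_T` of record.  (v) Constants as in the `Ω = T^{(0)}` files,
not optimized; the factor `e^{δ₀/2}` of §3 displayed.  `set_option maxHeartbeats 400000` on §§1–3 (long statements).  Imports: this gen's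
`BIJ88LocHolder231TorusOfInputs` (→ `BIJ88LocDeriv231TorusOfInputs` → r18 `BIJ88Close231WholeTorusFlatCwt`; p31 `BIJ88DeltaLocClose235General`;
gen 28 `BIJ88LocDeriv230SmallFieldTorus`).  Literature + Mathlib only.  Unit `lit-balaban-p29` (literature-prover-lit-balaban-p29-g30-0),
2026-08-23.  NOT summit progress.
-/

open scoped BigOperators Matrix ComplexConjugate
open Finset Matrix

namespace Literature.MathematicalPhysics.QuantumFieldTheory.BalabanImbrieJaffe1984to88.BIJ88Loc231RegionOfInputs

open Literature.MathematicalPhysics.QuantumFieldTheory.Balaban1983to89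
open BIJ88Sect3Statements (U1 toC cfg covD norm_toC)
open BIJ85BlockAveragesTorus BIJ85BlockAveragesTorusK
open BIJ88NeumannPropagator227Torus (gBox)
open BIJ88DeltaLoc234Torus (gLocT)
open BIJ88NeumannPropagatorFlatDecayCube (cubeT boxCoord)
open BIJ88Cutoffs21 (cutoff cutoff_nonneg cutoff_le_one)
open BIJ88LocWeights227Torus
open BIJ88Close231WholeTorusFlatCwt (rowHyp_ii_torus lt_T_of_not_mem)
open BIJ88DeltaLocClose235General (opClose231_gen)
open BIJ88LocDeriv230SmallFieldTorus (norm_transport_sub_le_sum_covD exists_admissible_contour)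
open BIJ88LocHolder231TorusOfInputs (weighted_transport_sub_le)
open BIJ88NeumannPropagatorFlatClose231 (norm_rowSource_le rowSource_ne_zero abs_lam_le_one)
open BIJ88LocDeriv230FlatTorus (exists_abs_cutoff_sub_le T_shift_le_one abs_T_shift_sub_le norm_rowSource_sub_le)
open BIJ88LocDeriv231FlatTorus (covD_gLocT_sub_apply norm_tail_le norm_tailDiff_le T_gt_of_tail_ne_zero T_gt_of_tailDiff_ne_zero)
open T4TreeGaugeFixing (Joins)
open T4TreeGaugeTransform (chainHol)

noncomputable section

variable {d : ℕ} {P : Params}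

/-- kernel: a deeper chart margin implies a shallower one. [folklore] -/
private theorem depth_mono (hPd : P.d = d + 1) {n : ℕ} {c M0 : Fin (d + 1) → ℕ} {D D' : ℝ} (hDD : D ≤ D') {x : Balaban1983to89.Site P 0}
    (hdeep : ∀ i, D' ≤ (boxCoord hPd n c x i : ℝ) ∧ (boxCoord hPd n c x i : ℝ) + D' ≤ (n * M0 i : ℕ) - 1) :
    ∀ i, D ≤ (boxCoord hPd n c x i : ℝ) ∧ (boxCoord hPd n c x i : ℝ) + D ≤ (n * M0 i : ℕ) - 1 :=
  fun i => ⟨hDD.trans (hdeep i).1, by linarith [(hdeep i).2]⟩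

/-- kernel: `e^{−δ'E} ≤ e^{−δE}` for `δ ≤ δ'`, `E ≥ 0`. [folklore] -/
private theorem exp_le_exp_of_rate {δ δ' E : ℝ} (hδ : δ ≤ δ') (hE : 0 ≤ E) : Real.exp (-(δ' * E)) ≤ Real.exp (-(δ * E)) :=
  Real.exp_le_exp.2 (neg_le_neg (mul_le_mul_of_nonneg_right hδ hE))

/-- kernel: the covariant derivative is additive in the function. [cite: BalabanImbrieJaffe1988, (3.3) p.265] -/
private theorem covD_sub {j : ℕ} (c' : ℝ) (u : PBond P j → ℂ) (φ ψ : Balaban1983to89.Site P j → ℂ) (b : PBond P j) :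
    covD c' u (φ - ψ) b = covD c' u φ b - covD c' u ψ b := by
  simp only [covD, Pi.sub_apply]; ring

/-! ## §1 The covariant-derivative analogue of (2.31) for a general region `Ω ⊇ Ω₀` -/

set_option maxHeartbeats 400000 in
/-- **THE COVARIANT-DERIVATIVE ANALOGUE OF (2.31) FOR A GENERAL REGION `Ω ⊇ Ω₀`, PRINTED LOCALIZATION DATA, ARBITRARY `U(1)` FIELD, FROM THE
FOUR [6]-INPUTS AS HYPOTHESES** (p. 263: *"|(G_{k,loc}(u)f − G_k(Ω,u)f)(x)| ≦ … (2.31) for dist(x, Ω^c) ≧ O(r(e_k)) … for (2.31) we assume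
smoothness throughout the subset Ω ⊂ T_η … Bounds analogous to (2.30), (2.31) hold for covariant derivatives …"*).  As
`BIJ88LocDeriv231TorusOfInputs.deriv231_wholeTorus_of_inputs` (the case `Ω = T^{(0)}`), with the comparison propagator `G_k(Ω,u) =
gBox A ε⁻¹ u k Ω` of an ARBITRARY finite region `Ω` containing the reference box `Ω₀` that carries the data: (H1)/(H2) are asked for the fitting
no-wrap cubes `□ ⊆ Ω` against `G_k(Ω,u)`, (H3)/(H4) for `G_k(Ω,u)` at the rows `x ∈ Ω` with `dist_∞(x, T∖Ω) ≥ ρ`; the conclusion is the same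
bound for `‖D_u(G_{k,loc}(u)f)(x,μ) − D_u(G_k(Ω,u)f)(x,μ)‖` at every bond with both ends in `Ω₀` at chart depth `≥ R₀ + R`, `R > ρ + 1`
(such rows are `ρ`-deep in `Ω ⊇ Ω₀`: r18's `lt_T_of_not_mem`; the active cubes lie in `Ω₀ ⊆ Ω`: gen 26's `cubeOf_subset`).
[cite: BalabanImbrieJaffe1988, (2.31) p.263] [cite: Balaban1983RegularityDecay, Theorem p.573 (1.10)–(1.12)] -/
theorem deriv231_region_of_inputs (d : ℕ) {c₀ : ℝ} (hc₀ : 0 ≤ c₀) :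
    ∃ C : ℝ, 0 < C ∧ ∀ (P : Params) (hPd : P.d = d + 1) (a : ℝ) (k : ℕ), 1 ≤ k → k ≤ P.K →
      ∀ (U : GaugeField P 0 U1) (Ω : Finset (Balaban1983to89.Site P 0)) (δ₀ ρ : ℝ), 0 < δ₀ → 0 ≤ ρ →
      -- (H1) the (1.11)–(1.12) covariant-derivative closeness member for the fitting no-wrap cubes `□ ⊆ Ω`
      (∀ (c' M' : Fin (d + 1) → ℕ), (∀ i, 1 ≤ M' i) → (∀ i, c' i * P.L ^ k + P.L ^ k * M' i ≤ P.sitesPerDir 0) →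
          (∀ i, P.L ^ k * M' i < P.sitesPerDir 0) → (cubeT hPd (P.L ^ k) c' fun i => P.L ^ k * M' i) ⊆ Ω →
        ∀ (x : Balaban1983to89.Site P 0) (μ : Fin P.d), x ∈ (cubeT hPd (P.L ^ k) c' fun i => P.L ^ k * M' i) →
          x.shift μ ∈ (cubeT hPd (P.L ^ k) c' fun i => P.L ^ k * M' i) →
          (∀ w, w ∉ (cubeT hPd (P.L ^ k) c' fun i => P.L ^ k * M' i) → ρ ≤ B5Ineq137Torus.T P 0 x w) →
        ∀ (g : Balaban1983to89.Site P 0 → ℂ) (F D Db Df : ℝ), (∀ y, ‖g y‖ ≤ F) →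
          (∀ y, y ∉ (cubeT hPd (P.L ^ k) c' fun i => P.L ^ k * M' i) → g y = 0) →
          0 ≤ D → (∀ y, g y ≠ 0 → D ≤ B5Ineq137Torus.T P 0 x y) →
          0 ≤ Db → (∀ w, w ∉ (cubeT hPd (P.L ^ k) c' fun i => P.L ^ k * M' i) → Db ≤ B5Ineq137Torus.T P 0 x w) →
          0 ≤ Df → (∀ y, g y ≠ 0 → ∀ w, w ∉ (cubeT hPd (P.L ^ k) c' fun i => P.L ^ k * M' i) → Df ≤ B5Ineq137Torus.T P 0 y w) →
          ‖covD P.eps⁻¹ (cfg U) (gBox (B1RG242Torus.α P a k * (P.L : ℝ) ^ (k * P.d)) P.eps⁻¹ U k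
                  (cubeT hPd (P.L ^ k) c' fun i => P.L ^ k * M' i) *ᵥ g) ⟨x, μ⟩ -
              covD P.eps⁻¹ (cfg U) (gBox (B1RG242Torus.α P a k * (P.L : ℝ) ^ (k * P.d)) P.eps⁻¹ U k Ω *ᵥ g) ⟨x, μ⟩‖ ≤
            P.spacing k * (c₀ * Real.exp (-(δ₀ * (((P.L : ℝ) ^ k)⁻¹ * D))) * Real.exp (-(δ₀ * (((P.L : ℝ) ^ k)⁻¹ * (Db + Df)))) * F)) →
      -- (H2) the (1.11)–(1.12) value closeness member for the same cubes and rows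
      (∀ (c' M' : Fin (d + 1) → ℕ), (∀ i, 1 ≤ M' i) → (∀ i, c' i * P.L ^ k + P.L ^ k * M' i ≤ P.sitesPerDir 0) →
          (∀ i, P.L ^ k * M' i < P.sitesPerDir 0) → (cubeT hPd (P.L ^ k) c' fun i => P.L ^ k * M' i) ⊆ Ω →
        ∀ (x : Balaban1983to89.Site P 0), x ∈ (cubeT hPd (P.L ^ k) c' fun i => P.L ^ k * M' i) →
          (∀ w, w ∉ (cubeT hPd (P.L ^ k) c' fun i => P.L ^ k * M' i) → ρ ≤ B5Ineq137Torus.T P 0 x w) →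
        ∀ (g : Balaban1983to89.Site P 0 → ℂ) (F D Db Df : ℝ), (∀ y, ‖g y‖ ≤ F) →
          (∀ y, y ∉ (cubeT hPd (P.L ^ k) c' fun i => P.L ^ k * M' i) → g y = 0) →
          0 ≤ D → (∀ y, g y ≠ 0 → D ≤ B5Ineq137Torus.T P 0 x y) →
          0 ≤ Db → (∀ w, w ∉ (cubeT hPd (P.L ^ k) c' fun i => P.L ^ k * M' i) → Db ≤ B5Ineq137Torus.T P 0 x w) →
          0 ≤ Df → (∀ y, g y ≠ 0 → ∀ w, w ∉ (cubeT hPd (P.L ^ k) c' fun i => P.L ^ k * M' i) → Df ≤ B5Ineq137Torus.T P 0 y w) →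
          ‖(gBox (B1RG242Torus.α P a k * (P.L : ℝ) ^ (k * P.d)) P.eps⁻¹ U k (cubeT hPd (P.L ^ k) c' fun i => P.L ^ k * M' i) *ᵥ g) x -
              (gBox (B1RG242Torus.α P a k * (P.L : ℝ) ^ (k * P.d)) P.eps⁻¹ U k Ω *ᵥ g) x‖ ≤
            P.spacing k ^ 2 * (c₀ * Real.exp (-(δ₀ * (((P.L : ℝ) ^ k)⁻¹ * D))) * Real.exp (-(δ₀ * (((P.L : ℝ) ^ k)⁻¹ * (Db + Df)))) * F)) →
      -- (H3) the (1.10) covariant-derivative member of `G_k(Ω,u)` at the `ρ`-deep rows of `Ω`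
      (∀ (x : Balaban1983to89.Site P 0), x ∈ Ω → (∀ w, w ∉ Ω → ρ ≤ B5Ineq137Torus.T P 0 x w) →
        ∀ (μ : Fin P.d) (g : Balaban1983to89.Site P 0 → ℂ) (F D : ℝ), (∀ y, ‖g y‖ ≤ F) → 0 ≤ D →
          (∀ y, g y ≠ 0 → D ≤ B5Ineq137Torus.T P 0 x y) →
          ‖covD P.eps⁻¹ (cfg U) (gBox (B1RG242Torus.α P a k * (P.L : ℝ) ^ (k * P.d)) P.eps⁻¹ U k Ω *ᵥ g) ⟨x, μ⟩‖ ≤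
            P.spacing k * (c₀ * Real.exp (-(δ₀ * (((P.L : ℝ) ^ k)⁻¹ * D))) * F)) →
      -- (H4) the (1.10) value member of `G_k(Ω,u)` at the `ρ`-deep rows of `Ω`
      (∀ (x : Balaban1983to89.Site P 0), x ∈ Ω → (∀ w, w ∉ Ω → ρ ≤ B5Ineq137Torus.T P 0 x w) →
        ∀ (g : Balaban1983to89.Site P 0 → ℂ) (F D : ℝ), (∀ y, ‖g y‖ ≤ F) → 0 ≤ D →
          (∀ y, g y ≠ 0 → D ≤ B5Ineq137Torus.T P 0 x y) →
          ‖(gBox (B1RG242Torus.α P a k * (P.L : ℝ) ^ (k * P.d)) P.eps⁻¹ U k Ω *ᵥ g) x‖ ≤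
            P.spacing k ^ 2 * (c₀ * Real.exp (-(δ₀ * (((P.L : ℝ) ^ k)⁻¹ * D))) * F)) →
      ∀ (c M0 : Fin (d + 1) → ℕ), (∀ i, 1 ≤ M0 i) →
        (∀ i, c i * P.L ^ k + P.L ^ k * M0 i ≤ P.sitesPerDir 0) → (∀ i, P.L ^ k * M0 i < P.sitesPerDir 0) →
        (cubeT hPd (P.L ^ k) c fun i => P.L ^ k * M0 i) ⊆ Ω →
      ∀ (s W : ℕ), 1 ≤ s → ∀ (R R₀ R₁ : ℝ), ρ + 1 < R → 0 ≤ R₁ → R₁ < R₀ → 2 * (s : ℝ) / 3 + R₀ / 2 + R ≤ W →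
        (∀ i, ((P.L ^ k * M0 i : ℕ) : ℝ) + R ≤ P.sitesPerDir 0) →
      ∀ (x : Balaban1983to89.Site P 0) (μ : Fin P.d),
        x ∈ (cubeT hPd (P.L ^ k) c fun i => P.L ^ k * M0 i) →
        (∀ i, R₀ + R ≤ (boxCoord hPd (P.L ^ k) c x i : ℝ) ∧ (boxCoord hPd (P.L ^ k) c x i : ℝ) + (R₀ + R) ≤ (P.L ^ k * M0 i : ℕ) - 1) →
        x.shift μ ∈ (cubeT hPd (P.L ^ k) c fun i => P.L ^ k * M0 i) →
        (∀ i, R₀ + R ≤ (boxCoord hPd (P.L ^ k) c (x.shift μ) i : ℝ) ∧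
          (boxCoord hPd (P.L ^ k) c (x.shift μ) i : ℝ) + (R₀ + R) ≤ (P.L ^ k * M0 i : ℕ) - 1) →
      ∀ (f : Balaban1983to89.Site P 0 → ℂ) (F D : ℝ), (∀ y, ‖f y‖ ≤ F) → 0 ≤ D → (∀ y, f y ≠ 0 → D ≤ B5Ineq137Torus.T P 0 x y) →
        ‖covD P.eps⁻¹ (cfg U)
              (gLocT (B1RG242Torus.α P a k * (P.L : ℝ) ^ (k * P.d)) P.eps⁻¹ U k
                (cubeFam hPd (P.L ^ k) c M0 s W) (lamFam hPd (P.L ^ k) c M0 s) (cutoff R₁ R₀ (B5Ineq137Torus.T P 0)) *ᵥ f) ⟨x, μ⟩ -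
            covD P.eps⁻¹ (cfg U) (gBox (B1RG242Torus.α P a k * (P.L : ℝ) ^ (k * P.d)) P.eps⁻¹ U k Ω *ᵥ f) ⟨x, μ⟩‖ ≤
          P.spacing k * (C * ((⌊(((P.L : ℝ) ^ k) - 1 + R₀) / s⌋₊ + 3) ^ (d + 1) * (1 + (P.L : ℝ) ^ k * ((R₀ - R₁)⁻¹ + (s : ℝ)⁻¹)) *
              Real.exp (-(δ₀ * (((P.L : ℝ) ^ k)⁻¹ * (2 * R - 1)))) +
            (1 + (P.L : ℝ) ^ k * (R₀ - R₁)⁻¹) * Real.exp (-(δ₀ / 2 * (((P.L : ℝ) ^ k)⁻¹ * (R₁ - 1))))) *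
            Real.exp (-(δ₀ / 2 * (((P.L : ℝ) ^ k)⁻¹ * D))) * F) := by
  obtain ⟨K, hK0, hK⟩ := exists_abs_cutoff_sub_le
  set Λ₀ : ℝ := max K (3 * Real.pi * (d + 1 : ℕ) / 2) with hΛ₀def
  have hΛ₀0 : 0 ≤ Λ₀ := hK0.trans (le_max_left _ _)
  have hΛ₀K : K ≤ Λ₀ := le_max_left _ _
  set C : ℝ := max c₀ (2 * c₀ * Λ₀ + 1) with hCdef
  have hC1 : c₀ ≤ C := le_max_left _ _
  have hC2 : 2 * c₀ * Λ₀ + 1 ≤ C := le_max_right _ _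
  have hC3 : c₀ ≤ C := hC1
  have hC4 : c₀ * Λ₀ + 1 ≤ C := by
    have : 0 ≤ c₀ * Λ₀ := mul_nonneg hc₀ hΛ₀0
    linarith
  have hC0 : 0 ≤ C := hc₀.trans hC1
  refine ⟨C, lt_of_lt_of_le (by linarith [mul_nonneg hc₀ hΛ₀0]) hC2, ?_⟩
  intro P hPd a k _hk1 hkK U Ω δ₀ ρ hδ₀ hρ H1 H2 H3 H4 c M0 hM0 hfit0 hN0 hΩ s W hs R R₀ R₁ hR hR₁ hR10 hW hgap x μ hx hdeep hxe hdeepe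
    f F D hF hD hsupp
  have hn : 1 ≤ P.L ^ k := Nat.one_le_pow _ _ P.L_pos
  have hk : 0 + k ≤ P.m + P.K := by omega
  have hR1 : 1 < R := by linarith
  have hR0 : 0 ≤ R := by linarith
  have hR₀ : 0 ≤ R₀ := hR₁.trans hR10.le
  have hs0 : 0 < s := hs
  have hsr : (0 : ℝ) < s := by exact_mod_cast hs0
  have hgap' : 0 < R₀ - R₁ := sub_pos.2 hR10
  have hLpos : (0 : ℝ) < P.L := P.cast_L_pos
  have hLk : (0 : ℝ) < (P.L : ℝ) ^ k := pow_pos hLpos _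
  have hε : 0 < ((P.L : ℝ) ^ k)⁻¹ := inv_pos.mpr hLk
  have hF0 : 0 ≤ F := (norm_nonneg _).trans (hF x)
  have hsp0 : 0 < P.spacing k := P.spacing_pos k
  have heps : 0 < P.eps := P.eps_pos
  have hζ0 := cutoff_eq_zero_of_le (P := P) hR10
  -- the shallower depth `R₀` (row hypothesis (i), the label multiplicities) at both endpoints
  have hdeep₀ := depth_mono hPd (show R₀ ≤ R₀ + R by linarith) hdeep
  have hdeepe₀ := depth_mono hPd (show R₀ ≤ R₀ + R by linarith) hdeepe
  -- abbreviations
  set Ω₀ : Finset (Balaban1983to89.Site P 0) := cubeT hPd (P.L ^ k) c fun i => P.L ^ k * M0 i with hΩ₀def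
  set A : ℝ := B1RG242Torus.α P a k * (P.L : ℝ) ^ (k * P.d) with hAdef
  set ζ := cutoff R₁ R₀ (B5Ineq137Torus.T P 0) with hζdef
  set x' := x.shift μ with hx'def
  set G₀ := gBox A P.eps⁻¹ U k Ω with hG₀def
  -- the row `x` inside `Ω`, `ρ`-deep with respect to `T ∖ Ω ⊆ T ∖ Ω₀`
  have hxΩ : x ∈ Ω := hΩ hx
  have hρΩ : ∀ w, w ∉ Ω → ρ ≤ B5Ineq137Torus.T P 0 x w := fun w hw =>
    (lt_T_of_not_mem hPd hfit0 (depth_mono hPd (show ρ ≤ R₀ + R by linarith) hdeep) (fun h => hw (hΩ h))).le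
  set m : ℝ := ((⌊(((P.L : ℝ) ^ k) - 1 + R₀) / s⌋₊ : ℝ) + 3) ^ (d + 1) with hmdef
  have hm0 : 0 ≤ m := by rw [hmdef]; positivity
  set E : ℝ := Real.exp (-(δ₀ / 2 * (((P.L : ℝ) ^ k)⁻¹ * D))) with hEdef
  set E2R : ℝ := Real.exp (-(δ₀ * (((P.L : ℝ) ^ k)⁻¹ * (2 * R - 1)))) with hE2Rdef
  set ER1 : ℝ := Real.exp (-(δ₀ / 2 * (((P.L : ℝ) ^ k)⁻¹ * (R₁ - 1)))) with hER1def
  have hE0 : 0 < E := Real.exp_pos _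
  have hE2R0 : 0 < E2R := Real.exp_pos _
  have hER10 : 0 < ER1 := Real.exp_pos _
  have hεD : 0 ≤ ((P.L : ℝ) ^ k)⁻¹ * D := mul_nonneg hε.le hD
  have hε2R : 0 ≤ ((P.L : ℝ) ^ k)⁻¹ * (2 * R - 1) := mul_nonneg hε.le (by linarith)
  -- exponent bookkeeping: `e^{−δ_iD/L^k} ≤ E`-type facts
  have hED : ∀ {δ'}, δ₀ ≤ δ' → Real.exp (-(δ' * (((P.L : ℝ) ^ k)⁻¹ * D))) ≤ E := by
    intro δ' hδ'
    refine (exp_le_exp_of_rate hδ' hεD).trans (Real.exp_le_exp.2 ?_)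
    have := mul_nonneg hδ₀.le hεD
    linarith
  have hE2 : ∀ {δ'}, δ₀ ≤ δ' → Real.exp (-(δ' * (((P.L : ℝ) ^ k)⁻¹ * (R - 1 + R)))) ≤ E2R := by
    intro δ' hδ'
    rw [show R - 1 + R = 2 * R - 1 by ring]
    exact exp_le_exp_of_rate hδ' hε2R
  set D' : ℝ := max D (R₁ - 1) with hD'def
  have hD'D : D ≤ D' := le_max_left _ _
  have hD'R : R₁ - 1 ≤ D' := le_max_right _ _
  have hD'0 : 0 ≤ D' := hD.trans hD'D
  have hED' : ∀ {δ'}, δ₀ ≤ δ' → Real.exp (-(δ' * (((P.L : ℝ) ^ k)⁻¹ * D'))) ≤ E * ER1 := by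
    intro δ' hδ'
    rw [hEdef, hER1def, ← Real.exp_add]
    refine Real.exp_le_exp.2 ?_
    have hD'0' : 0 ≤ ((P.L : ℝ) ^ k)⁻¹ * D' := mul_nonneg hε.le hD'0
    have h1 : δ₀ * (((P.L : ℝ) ^ k)⁻¹ * D') ≤ δ' * (((P.L : ℝ) ^ k)⁻¹ * D') := mul_le_mul_of_nonneg_right hδ' hD'0'
    have h2 : δ₀ / 2 * (((P.L : ℝ) ^ k)⁻¹ * D) + δ₀ / 2 * (((P.L : ℝ) ^ k)⁻¹ * (R₁ - 1)) ≤ δ₀ * (((P.L : ℝ) ^ k)⁻¹ * D') := by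
      have : D + (R₁ - 1) ≤ 2 * D' := by linarith
      calc δ₀ / 2 * (((P.L : ℝ) ^ k)⁻¹ * D) + δ₀ / 2 * (((P.L : ℝ) ^ k)⁻¹ * (R₁ - 1))
          = δ₀ / 2 * (((P.L : ℝ) ^ k)⁻¹ * (D + (R₁ - 1))) := by ring
        _ ≤ δ₀ / 2 * (((P.L : ℝ) ^ k)⁻¹ * (2 * D')) :=
            mul_le_mul_of_nonneg_left (mul_le_mul_of_nonneg_left this hε.le) (by positivity)
        _ = δ₀ * (((P.L : ℝ) ^ k)⁻¹ * D') := by ring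
    linarith
  -- the sources
  set g' : ↥(labels (P.L ^ k) M0 s) → Balaban1983to89.Site P 0 → ℂ :=
    fun α y => (ζ x' y : ℂ) * (lamFam hPd (P.L ^ k) c M0 s α x' y : ℂ) * f y with hg'def
  set dg : ↥(labels (P.L ^ k) M0 s) → Balaban1983to89.Site P 0 → ℂ :=
    fun α y => ((ζ x' y : ℂ) * (lamFam hPd (P.L ^ k) c M0 s α x' y : ℂ) - (ζ x y : ℂ) * (lamFam hPd (P.L ^ k) c M0 s α x y : ℂ)) * f y
    with hdgdef
  set q' : Balaban1983to89.Site P 0 → ℂ := fun y => ((ζ x' y : ℂ) - 1) * f y with hq'def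
  set dq : Balaban1983to89.Site P 0 → ℂ := fun y => ((ζ x' y : ℂ) - (ζ x y : ℂ)) * f y with hdqdef
  -- the four-term identity (row hypothesis (i) at both endpoints)
  have hid : covD P.eps⁻¹ (cfg U) (gLocT A P.eps⁻¹ U k (cubeFam hPd (P.L ^ k) c M0 s W) (lamFam hPd (P.L ^ k) c M0 s) ζ *ᵥ f) ⟨x, μ⟩ -
      covD P.eps⁻¹ (cfg U) (G₀ *ᵥ f) ⟨x, μ⟩ =
      ∑ α, (covD P.eps⁻¹ (cfg U) (gBox A P.eps⁻¹ U k (cubeFam hPd (P.L ^ k) c M0 s W α) *ᵥ g' α) ⟨x, μ⟩ -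
              covD P.eps⁻¹ (cfg U) (G₀ *ᵥ g' α) ⟨x, μ⟩) +
      ∑ α, ((P.eps⁻¹ : ℝ) : ℂ) * ((gBox A P.eps⁻¹ U k (cubeFam hPd (P.L ^ k) c M0 s W α) *ᵥ dg α) x - (G₀ *ᵥ dg α) x) +
      covD P.eps⁻¹ (cfg U) (G₀ *ᵥ q') ⟨x, μ⟩ + ((P.eps⁻¹ : ℝ) : ℂ) * (G₀ *ᵥ dq) x :=
    covD_gLocT_sub_apply P.eps⁻¹ (cfg U) A P.eps⁻¹ U k (cubeFam hPd (P.L ^ k) c M0 s W) (lamFam hPd (P.L ^ k) c M0 s) ζ G₀ f ⟨x, μ⟩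
      (rowHyp_i hPd hfit0 hζ0 hxe hdeepe₀) (rowHyp_i hPd hfit0 hζ0 hx hdeep₀)
  rw [hid]
  -- the active-label sets of the two endpoints
  set Sx : Finset ↥(labels (P.L ^ k) M0 s) := (activeLabels hPd (P.L ^ k) c s R₀ (blkIter k x)).subtype fun α => α ∈ labels (P.L ^ k) M0 s
    with hSxdef
  set Sx' : Finset ↥(labels (P.L ^ k) M0 s) := (activeLabels hPd (P.L ^ k) c s R₀ (blkIter k x')).subtype fun α => α ∈ labels (P.L ^ k) M0 s
    with hSx'def
  have hcardx : (Sx.card : ℝ) ≤ m := by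
    have h1 := card_subtype_activeLabels_le (hPd := hPd) (c := c) (M0 := M0) hn hs0 hR₀ (blkIter k x)
    have e : (((P.L ^ k : ℕ) : ℕ) : ℝ) = (P.L : ℝ) ^ k := by push_cast; rfl
    rw [hSxdef, hmdef]; rw [e] at h1; exact h1
  have hcardx' : (Sx'.card : ℝ) ≤ m := by
    have h1 := card_subtype_activeLabels_le (hPd := hPd) (c := c) (M0 := M0) hn hs0 hR₀ (blkIter k x')
    have e : (((P.L ^ k : ℕ) : ℕ) : ℝ) = (P.L : ℝ) ^ k := by push_cast; rfl
    rw [hSx'def, hmdef]; rw [e] at h1; exact h1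
  have hSx : ∀ (α : ↥(labels (P.L ^ k) M0 s)) (y : Balaban1983to89.Site P 0),
      ζ x y * lamFam hPd (P.L ^ k) c M0 s α x y ≠ 0 → α ∈ Sx := by
    intro α y hne
    rw [hSxdef, Finset.mem_subtype]
    exact mem_activeLabels_of_ne_zero_of_deep hk hs0 hfit0 hζ0 (mem_blockK.2 rfl) hdeep₀ hne
  have hSx' : ∀ (α : ↥(labels (P.L ^ k) M0 s)) (y : Balaban1983to89.Site P 0),
      ζ x' y * lamFam hPd (P.L ^ k) c M0 s α x' y ≠ 0 → α ∈ Sx' := by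
    intro α y hne
    rw [hSx'def, Finset.mem_subtype]
    exact mem_activeLabels_of_ne_zero_of_deep hk hs0 hfit0 hζ0 (mem_blockK.2 rfl) hdeepe₀ hne
  have hcardU : ((Sx ∪ Sx').card : ℝ) ≤ 2 * m := by
    have h1 : ((Sx ∪ Sx').card : ℝ) ≤ (Sx.card : ℝ) + (Sx'.card : ℝ) := by exact_mod_cast Finset.card_union_le _ _
    linarith
  -- geometry of an active cube READ AGAINST THE WHOLE TORUS: both endpoints and the active sources inside, `T_η ∖ □_α` far
  have hstep : B5Ineq137Torus.T P 0 x' x ≤ 1 := by rw [B5Ineq137Torus.T_symm]; exact T_shift_le_one x μ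
  have hgeo' : ∀ (α : ↥(labels (P.L ^ k) M0 s)) (y₀ : Balaban1983to89.Site P 0), ζ x' y₀ * lamFam hPd (P.L ^ k) c M0 s α x' y₀ ≠ 0 →
      x ∈ cubeFam hPd (P.L ^ k) c M0 s W α ∧ x' ∈ cubeFam hPd (P.L ^ k) c M0 s W α ∧
      (∀ w, w ∉ cubeFam hPd (P.L ^ k) c M0 s W α → R - 1 ≤ B5Ineq137Torus.T P 0 x w) := by
    intro α y₀ hy₀
    obtain ⟨hx'α, -, hfar⟩ := rowHyp_ii_torus hPd hn hs0 hfit0 hR0 hR₀ hgap hW hζ0 hxe hdeepe α y₀ hy₀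
    have hxα : x ∈ cubeFam hPd (P.L ^ k) c M0 s W α := by
      by_contra hnot
      have h1 := (hfar x hnot).1
      linarith
    refine ⟨hxα, hx'α, fun w hnot => ?_⟩
    have h1 := (hfar w hnot).1
    have h2 := abs_le.1 (abs_T_shift_sub_le x w μ)
    linarith
  have hgeo : ∀ (α : ↥(labels (P.L ^ k) M0 s)) (y₀ : Balaban1983to89.Site P 0), ζ x y₀ * lamFam hPd (P.L ^ k) c M0 s α x y₀ ≠ 0 →
      x ∈ cubeFam hPd (P.L ^ k) c M0 s W α ∧
      (∀ w, w ∉ cubeFam hPd (P.L ^ k) c M0 s W α → R - 1 ≤ B5Ineq137Torus.T P 0 x w) := by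
    intro α y₀ hy₀
    obtain ⟨hxα, -, hfar⟩ := rowHyp_ii_torus hPd hn hs0 hfit0 hR0 hR₀ hgap hW hζ0 hx hdeep α y₀ hy₀
    exact ⟨hxα, fun w hnot => by linarith [(hfar w hnot).1]⟩
  have hζabs : ∀ z y, |ζ z y| ≤ 1 := fun z y => by
    rw [hζdef, abs_of_nonneg (cutoff_nonneg _ _ _ _ _)]; exact cutoff_le_one _ _ _ _ _
  -- TERM 1: the (1.11)–(1.12) covariant-derivative closeness input (H1) for the cubes active at `x'`
  set B₁ : ℝ := P.spacing k * (c₀ * Real.exp (-(δ₀ * (((P.L : ℝ) ^ k)⁻¹ * D))) *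
    Real.exp (-(δ₀ * (((P.L : ℝ) ^ k)⁻¹ * (R - 1 + R)))) * F) with hB₁def
  have hB₁0 : 0 ≤ B₁ := by positivity
  have hterm1 : ∀ α, ‖covD P.eps⁻¹ (cfg U) (gBox A P.eps⁻¹ U k (cubeFam hPd (P.L ^ k) c M0 s W α) *ᵥ g' α) ⟨x, μ⟩ -
      covD P.eps⁻¹ (cfg U) (G₀ *ᵥ g' α) ⟨x, μ⟩‖ ≤ B₁ := by
    intro α
    by_cases hex : ∃ y, ζ x' y * lamFam hPd (P.L ^ k) c M0 s α x' y ≠ 0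
    · obtain ⟨y₀, hy₀⟩ := hex
      obtain ⟨hxα, hx'α, hfarx⟩ := hgeo' α y₀ hy₀
      obtain ⟨c', M', hM', hfit', hN', hcα⟩ := cubeFam_fits (hPd := hPd) (n := P.L ^ k) (c := c) (s := s) (W := W) hM0 hfit0 hN0 α
      have hsuppα : ∀ y, y ∉ cubeFam hPd (P.L ^ k) c M0 s W α → g' α y = 0 := by
        intro y hy
        by_contra hne
        exact hy (rowHyp_ii_torus hPd hn hs0 hfit0 hR0 hR₀ hgap hW hζ0 hxe hdeepe α y (rowSource_ne_zero hne).1).2.1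
      have hDf : ∀ y, g' α y ≠ 0 → ∀ w, w ∉ cubeFam hPd (P.L ^ k) c M0 s W α → R ≤ B5Ineq137Torus.T P 0 y w :=
        fun y hy w hw' => ((rowHyp_ii_torus hPd hn hs0 hfit0 hR0 hR₀ hgap hW hζ0 hxe hdeepe α y (rowSource_ne_zero hy).1).2.2 w hw').2
      rw [hcα] at hxα hx'α hfarx hsuppα hDf ⊢
      have hρx : ∀ w, w ∉ (cubeT hPd (P.L ^ k) c' fun i => P.L ^ k * M' i) → ρ ≤ B5Ineq137Torus.T P 0 x w :=
        fun w hw => by linarith [hfarx w hw]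
      exact H1 c' M' hM' hfit' hN' (hcα ▸ (cubeOf_subset α.1).trans hΩ) x μ hxα hx'α hρx (g' α) F D (R - 1) R
        (fun y => norm_rowSource_le (hζabs x' y) (abs_lam_le_one (sum_abs_lamT_le_one hfit0) α x' y) hF y)
        hsuppα hD (fun y hy => hsupp y (rowSource_ne_zero hy).2) (by linarith) hfarx hR0 hDf
    · push Not at hex
      have h0 : g' α = 0 := by
        funext y; rw [hg'def]; dsimp only; rw [← Complex.ofReal_mul, hex y, Complex.ofReal_zero, zero_mul]; rfl
      rw [h0, mulVec_zero, mulVec_zero]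
      simp only [covD, Pi.zero_apply, mul_zero, sub_zero, norm_zero]
      exact hB₁0
  have hzero1 : ∀ α, α ∉ Sx' → covD P.eps⁻¹ (cfg U) (gBox A P.eps⁻¹ U k (cubeFam hPd (P.L ^ k) c M0 s W α) *ᵥ g' α) ⟨x, μ⟩ -
      covD P.eps⁻¹ (cfg U) (G₀ *ᵥ g' α) ⟨x, μ⟩ = 0 := by
    intro α hα
    have h0 : g' α = 0 := by
      funext y
      by_contra hne
      exact hα (hSx' α y (rowSource_ne_zero hne).1)
    rw [h0, mulVec_zero, mulVec_zero]
    simp only [covD, Pi.zero_apply, mul_zero, sub_zero]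
  have hsum1 : ‖∑ α, (covD P.eps⁻¹ (cfg U) (gBox A P.eps⁻¹ U k (cubeFam hPd (P.L ^ k) c M0 s W α) *ᵥ g' α) ⟨x, μ⟩ -
      covD P.eps⁻¹ (cfg U) (G₀ *ᵥ g' α) ⟨x, μ⟩)‖ ≤ m * B₁ := by
    rw [← Finset.sum_subset (Finset.subset_univ Sx') (fun α _ hα => hzero1 α hα)]
    calc ‖∑ α ∈ Sx', (covD P.eps⁻¹ (cfg U) (gBox A P.eps⁻¹ U k (cubeFam hPd (P.L ^ k) c M0 s W α) *ᵥ g' α) ⟨x, μ⟩ -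
            covD P.eps⁻¹ (cfg U) (G₀ *ᵥ g' α) ⟨x, μ⟩)‖
        ≤ ∑ α ∈ Sx', ‖covD P.eps⁻¹ (cfg U) (gBox A P.eps⁻¹ U k (cubeFam hPd (P.L ^ k) c M0 s W α) *ᵥ g' α) ⟨x, μ⟩ -
            covD P.eps⁻¹ (cfg U) (G₀ *ᵥ g' α) ⟨x, μ⟩‖ := norm_sum_le _ _
      _ ≤ ∑ α ∈ Sx', B₁ := Finset.sum_le_sum fun α _ => hterm1 α
      _ = Sx'.card * B₁ := by rw [Finset.sum_const, nsmul_eq_mul]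
      _ ≤ m * B₁ := mul_le_mul_of_nonneg_right hcardx' hB₁0
  -- TERM 2: the (1.11)–(1.12) value closeness input (H2) on the difference sources, cubes active at `x` or `x'`
  set Λ : ℝ := K / (R₀ - R₁) + 3 * Real.pi * (d + 1 : ℕ) / (2 * s) with hΛdef
  have hΛ0 : 0 ≤ Λ := by rw [hΛdef]; positivity
  set B₂ : ℝ := P.spacing k ^ 2 * (c₀ * Real.exp (-(δ₀ * (((P.L : ℝ) ^ k)⁻¹ * D))) *
    Real.exp (-(δ₀ * (((P.L : ℝ) ^ k)⁻¹ * (R - 1 + R)))) * (Λ * F)) with hB₂def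
  have hB₂0 : 0 ≤ B₂ := by positivity
  have hterm2 : ∀ α, ‖(gBox A P.eps⁻¹ U k (cubeFam hPd (P.L ^ k) c M0 s W α) *ᵥ dg α) x - (G₀ *ᵥ dg α) x‖ ≤ B₂ := by
    intro α
    by_cases hex : ∃ y, dg α y ≠ 0
    · obtain ⟨y₀, hy₀⟩ := hex
      -- an active pair at one endpoint: `x` is in the cube and `T_η ∖ □_α` is `≥ R − 1` away from `x`
      have hact : ∀ y, dg α y ≠ 0 → ζ x' y * lamFam hPd (P.L ^ k) c M0 s α x' y ≠ 0 ∨ ζ x y * lamFam hPd (P.L ^ k) c M0 s α x y ≠ 0 := by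
        intro y hy
        by_contra hno
        rw [not_or, not_not, not_not] at hno
        apply hy
        rw [hdgdef]; dsimp only
        rw [← Complex.ofReal_mul, ← Complex.ofReal_mul, hno.1, hno.2]; simp
      have hxfar : x ∈ cubeFam hPd (P.L ^ k) c M0 s W α ∧
          ∀ w, w ∉ cubeFam hPd (P.L ^ k) c M0 s W α → R - 1 ≤ B5Ineq137Torus.T P 0 x w := by
        rcases hact y₀ hy₀ with h1 | h1
        · exact ⟨(hgeo' α y₀ h1).1, (hgeo' α y₀ h1).2.2⟩
        · exact hgeo α y₀ h1
      obtain ⟨hxα, hfarx⟩ := hxfar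
      obtain ⟨c', M', hM', hfit', hN', hcα⟩ := cubeFam_fits (hPd := hPd) (n := P.L ^ k) (c := c) (s := s) (W := W) hM0 hfit0 hN0 α
      have hsuppα : ∀ y, y ∉ cubeFam hPd (P.L ^ k) c M0 s W α → dg α y = 0 := by
        intro y hy
        by_contra hne
        rcases hact y hne with h1 | h1
        · exact hy (rowHyp_ii_torus hPd hn hs0 hfit0 hR0 hR₀ hgap hW hζ0 hxe hdeepe α y h1).2.1
        · exact hy (rowHyp_ii_torus hPd hn hs0 hfit0 hR0 hR₀ hgap hW hζ0 hx hdeep α y h1).2.1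
      have hDf : ∀ y, dg α y ≠ 0 → ∀ w, w ∉ cubeFam hPd (P.L ^ k) c M0 s W α → R ≤ B5Ineq137Torus.T P 0 y w := by
        intro y hy w hw'
        rcases hact y hy with h1 | h1
        · exact ((rowHyp_ii_torus hPd hn hs0 hfit0 hR0 hR₀ hgap hW hζ0 hxe hdeepe α y h1).2.2 w hw').2
        · exact ((rowHyp_ii_torus hPd hn hs0 hfit0 hR0 hR₀ hgap hW hζ0 hx hdeep α y h1).2.2 w hw').2
      rw [hcα] at hxα hfarx hsuppα hDf ⊢
      have hρx : ∀ w, w ∉ (cubeT hPd (P.L ^ k) c' fun i => P.L ^ k * M' i) → ρ ≤ B5Ineq137Torus.T P 0 x w :=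
        fun w hw => by linarith [hfarx w hw]
      exact H2 c' M' hM' hfit' hN' (hcα ▸ (cubeOf_subset α.1).trans hΩ) x hxα hρx (dg α) (Λ * F) D (R - 1) R
        (fun y => norm_rowSource_sub_le hPd hs0 hfit0 hN0 hK0 hR10 (hK R₁ R₀ hR10 (B5Ineq137Torus.T P 0)) α.1 hx hxe hF y)
        hsuppα hD (fun y hy => hsupp y (right_ne_zero_of_mul hy)) (by linarith) hfarx hR0 hDf
    · push Not at hex
      have h0 : dg α = 0 := funext hex
      rw [h0, mulVec_zero, mulVec_zero, Pi.zero_apply, sub_zero, norm_zero]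
      exact hB₂0
  have hzero2 : ∀ α, α ∉ Sx ∪ Sx' → (gBox A P.eps⁻¹ U k (cubeFam hPd (P.L ^ k) c M0 s W α) *ᵥ dg α) x - (G₀ *ᵥ dg α) x = 0 := by
    intro α hα
    rw [Finset.mem_union, not_or] at hα
    have h0 : dg α = 0 := by
      funext y
      rw [hdgdef]; dsimp only
      have h1 : ζ x' y * lamFam hPd (P.L ^ k) c M0 s α x' y = 0 := by
        by_contra hne; exact hα.2 (hSx' α y hne)
      have h2 : ζ x y * lamFam hPd (P.L ^ k) c M0 s α x y = 0 := by
        by_contra hne; exact hα.1 (hSx α y hne)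
      rw [← Complex.ofReal_mul, ← Complex.ofReal_mul, h1, h2]; simp
    rw [h0, mulVec_zero, mulVec_zero, Pi.zero_apply, sub_zero]
  have hsum2 : ‖∑ α, ((P.eps⁻¹ : ℝ) : ℂ) * ((gBox A P.eps⁻¹ U k (cubeFam hPd (P.L ^ k) c M0 s W α) *ᵥ dg α) x - (G₀ *ᵥ dg α) x)‖ ≤
      P.eps⁻¹ * (2 * m * B₂) := by
    rw [← Finset.mul_sum, norm_mul, Complex.norm_real, Real.norm_eq_abs, abs_of_pos (inv_pos.mpr heps)]
    refine mul_le_mul_of_nonneg_left ?_ (inv_pos.mpr heps).le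
    rw [← Finset.sum_subset (Finset.subset_univ (Sx ∪ Sx')) (fun α _ hα => hzero2 α hα)]
    calc ‖∑ α ∈ Sx ∪ Sx', ((gBox A P.eps⁻¹ U k (cubeFam hPd (P.L ^ k) c M0 s W α) *ᵥ dg α) x - (G₀ *ᵥ dg α) x)‖
        ≤ ∑ α ∈ Sx ∪ Sx', ‖(gBox A P.eps⁻¹ U k (cubeFam hPd (P.L ^ k) c M0 s W α) *ᵥ dg α) x - (G₀ *ᵥ dg α) x‖ := norm_sum_le _ _
      _ ≤ ∑ α ∈ Sx ∪ Sx', B₂ := Finset.sum_le_sum fun α _ => hterm2 α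
      _ = (Sx ∪ Sx').card * B₂ := by rw [Finset.sum_const, nsmul_eq_mul]
      _ ≤ 2 * m * B₂ := mul_le_mul_of_nonneg_right hcardU hB₂0
  -- TERM 3: the (1.10) covariant-derivative input (H3) for `G_k(T_η,u)` on the tail `q'`
  set B₃ : ℝ := P.spacing k * (c₀ * Real.exp (-(δ₀ * (((P.L : ℝ) ^ k)⁻¹ * D'))) * F) with hB₃def
  have hterm3 : ‖covD P.eps⁻¹ (cfg U) (G₀ *ᵥ q') ⟨x, μ⟩‖ ≤ B₃ := by
    have hsq : ∀ y, q' y ≠ 0 → D' ≤ B5Ineq137Torus.T P 0 x y := fun y hy => by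
      obtain ⟨hf, hT⟩ := T_gt_of_tail_ne_zero hR10 x μ hy
      exact max_le (hsupp y hf) hT.le
    exact H3 x hxΩ hρΩ μ q' F D' (fun y => norm_tail_le x' hF y) hD'0 hsq
  -- TERM 4: the (1.10) value input (H4) for `G_k(T_η,u)` on the tail difference `dq`
  set B₄ : ℝ := P.spacing k ^ 2 * (c₀ * Real.exp (-(δ₀ * (((P.L : ℝ) ^ k)⁻¹ * D'))) * (K / (R₀ - R₁) * F)) with hB₄def
  have hterm4 : ‖((P.eps⁻¹ : ℝ) : ℂ) * (G₀ *ᵥ dq) x‖ ≤ P.eps⁻¹ * B₄ := by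
    rw [norm_mul, Complex.norm_real, Real.norm_eq_abs, abs_of_pos (inv_pos.mpr heps)]
    refine mul_le_mul_of_nonneg_left ?_ (inv_pos.mpr heps).le
    have hsq : ∀ y, dq y ≠ 0 → D' ≤ B5Ineq137Torus.T P 0 x y := fun y hy => by
      obtain ⟨hf, hT⟩ := T_gt_of_tailDiff_ne_zero hR10 x μ hy
      exact max_le (hsupp y hf) hT.le
    exact H4 x hxΩ hρΩ dq (K / (R₀ - R₁) * F) D' (fun y => norm_tailDiff_le hK0 hR10 (hK R₁ R₀ hR10 (B5Ineq137Torus.T P 0)) x μ hF y)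
      hD'0 hsq
  -- assembling (verbatim from gen 27's `deriv231_flat_cwt` / r18's `deriv231_wholeTorus_flat_cwt`)
  have hscale : P.eps⁻¹ * P.spacing k ^ 2 = P.spacing k * (P.L : ℝ) ^ k := by
    rw [Params.spacing]
    field_simp
  have hΛle : Λ ≤ Λ₀ * ((R₀ - R₁)⁻¹ + (s : ℝ)⁻¹) := by
    rw [hΛdef, mul_add]
    refine add_le_add ?_ ?_
    · rw [div_eq_mul_inv]
      exact mul_le_mul_of_nonneg_right (le_max_left _ _) (inv_pos.mpr hgap').le
    · have e : 3 * Real.pi * (d + 1 : ℕ) / (2 * s) = (3 * Real.pi * (d + 1 : ℕ) / 2) * (s : ℝ)⁻¹ := by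
        field_simp
      rw [e]
      exact mul_le_mul_of_nonneg_right (le_max_right _ _) (inv_pos.mpr hsr).le
  have hKle : K / (R₀ - R₁) ≤ Λ₀ * (R₀ - R₁)⁻¹ := by
    rw [div_eq_mul_inv]; exact mul_le_mul_of_nonneg_right hΛ₀K (inv_pos.mpr hgap').le
  -- term 1 ≤ spacing·(C·m·E2R·E·F)
  have h1 : m * B₁ ≤ P.spacing k * (C * (m * 1 * E2R) * E * F) := by
    have : B₁ ≤ P.spacing k * (C * E2R * E * F) := by
      rw [hB₁def]
      refine mul_le_mul_of_nonneg_left ?_ hsp0.le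
      have := mul_le_mul (mul_le_mul hC1 (hED le_rfl) (Real.exp_pos _).le hC0) (hE2 le_rfl) (Real.exp_pos _).le (by positivity)
      calc c₀ * Real.exp (-(δ₀ * (((P.L : ℝ) ^ k)⁻¹ * D))) * Real.exp (-(δ₀ * (((P.L : ℝ) ^ k)⁻¹ * (R - 1 + R)))) * F
          ≤ C * E * E2R * F := mul_le_mul_of_nonneg_right this hF0
        _ = C * E2R * E * F := by ring
    calc m * B₁ ≤ m * (P.spacing k * (C * E2R * E * F)) := mul_le_mul_of_nonneg_left this hm0
      _ = P.spacing k * (C * (m * 1 * E2R) * E * F) := by ring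
  -- term 2 ≤ spacing·(C·m·L^k((R₀−R₁)⁻¹ + s⁻¹)·E2R·E·F)
  have h2 : P.eps⁻¹ * (2 * m * B₂) ≤ P.spacing k * (C * (m * ((P.L : ℝ) ^ k * ((R₀ - R₁)⁻¹ + (s : ℝ)⁻¹)) * E2R) * E * F) := by
    have e : P.eps⁻¹ * (2 * m * B₂) = P.spacing k * ((2 * c₀ * Λ) * m * (P.L : ℝ) ^ k *
        (Real.exp (-(δ₀ * (((P.L : ℝ) ^ k)⁻¹ * D))) * Real.exp (-(δ₀ * (((P.L : ℝ) ^ k)⁻¹ * (R - 1 + R))))) * F) := by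
      rw [hB₂def]
      have : P.eps⁻¹ * (2 * m * (P.spacing k ^ 2 * (c₀ * Real.exp (-(δ₀ * (((P.L : ℝ) ^ k)⁻¹ * D))) *
          Real.exp (-(δ₀ * (((P.L : ℝ) ^ k)⁻¹ * (R - 1 + R)))) * (Λ * F)))) =
          (P.eps⁻¹ * P.spacing k ^ 2) * (2 * c₀ * Λ * m *
            (Real.exp (-(δ₀ * (((P.L : ℝ) ^ k)⁻¹ * D))) * Real.exp (-(δ₀ * (((P.L : ℝ) ^ k)⁻¹ * (R - 1 + R))))) * F) := by ring
      rw [this, hscale]; ring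
    rw [e]
    refine mul_le_mul_of_nonneg_left ?_ hsp0.le
    have hcoef : 2 * c₀ * Λ * m * (P.L : ℝ) ^ k ≤ C * (m * ((P.L : ℝ) ^ k * ((R₀ - R₁)⁻¹ + (s : ℝ)⁻¹))) := by
      have h3 : 2 * c₀ * Λ ≤ C * ((R₀ - R₁)⁻¹ + (s : ℝ)⁻¹) := by
        calc 2 * c₀ * Λ ≤ 2 * c₀ * (Λ₀ * ((R₀ - R₁)⁻¹ + (s : ℝ)⁻¹)) := mul_le_mul_of_nonneg_left hΛle (by positivity)
          _ = (2 * c₀ * Λ₀) * ((R₀ - R₁)⁻¹ + (s : ℝ)⁻¹) := by ring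
          _ ≤ C * ((R₀ - R₁)⁻¹ + (s : ℝ)⁻¹) := mul_le_mul_of_nonneg_right (by linarith) (by positivity)
      calc 2 * c₀ * Λ * m * (P.L : ℝ) ^ k = (2 * c₀ * Λ) * (m * (P.L : ℝ) ^ k) := by ring
        _ ≤ (C * ((R₀ - R₁)⁻¹ + (s : ℝ)⁻¹)) * (m * (P.L : ℝ) ^ k) := mul_le_mul_of_nonneg_right h3 (by positivity)
        _ = C * (m * ((P.L : ℝ) ^ k * ((R₀ - R₁)⁻¹ + (s : ℝ)⁻¹))) := by ring
    have hexp : Real.exp (-(δ₀ * (((P.L : ℝ) ^ k)⁻¹ * D))) * Real.exp (-(δ₀ * (((P.L : ℝ) ^ k)⁻¹ * (R - 1 + R)))) ≤ E2R * E := by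
      calc _ ≤ E * E2R := mul_le_mul (hED le_rfl) (hE2 le_rfl) (Real.exp_pos _).le hE0.le
        _ = E2R * E := mul_comm _ _
    calc 2 * c₀ * Λ * m * (P.L : ℝ) ^ k *
          (Real.exp (-(δ₀ * (((P.L : ℝ) ^ k)⁻¹ * D))) * Real.exp (-(δ₀ * (((P.L : ℝ) ^ k)⁻¹ * (R - 1 + R))))) * F
        ≤ C * (m * ((P.L : ℝ) ^ k * ((R₀ - R₁)⁻¹ + (s : ℝ)⁻¹))) * (E2R * E) * F :=
          mul_le_mul_of_nonneg_right (mul_le_mul hcoef hexp (by positivity) (by positivity)) hF0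
      _ = C * (m * ((P.L : ℝ) ^ k * ((R₀ - R₁)⁻¹ + (s : ℝ)⁻¹)) * E2R) * E * F := by ring
  -- term 3 ≤ spacing·(C·1·ER1·E·F)
  have h3 : B₃ ≤ P.spacing k * (C * (1 * ER1) * E * F) := by
    rw [hB₃def]
    refine mul_le_mul_of_nonneg_left ?_ hsp0.le
    calc c₀ * Real.exp (-(δ₀ * (((P.L : ℝ) ^ k)⁻¹ * D'))) * F ≤ C * (E * ER1) * F :=
          mul_le_mul_of_nonneg_right (mul_le_mul hC3 (hED' le_rfl) (Real.exp_pos _).le hC0) hF0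
      _ = C * (1 * ER1) * E * F := by ring
  -- term 4 ≤ spacing·(C·L^k(R₀−R₁)⁻¹·ER1·E·F)
  have h4 : P.eps⁻¹ * B₄ ≤ P.spacing k * (C * ((P.L : ℝ) ^ k * (R₀ - R₁)⁻¹ * ER1) * E * F) := by
    have e : P.eps⁻¹ * B₄ = P.spacing k * ((c₀ * (K / (R₀ - R₁))) * (P.L : ℝ) ^ k * Real.exp (-(δ₀ * (((P.L : ℝ) ^ k)⁻¹ * D'))) * F) := by
      rw [hB₄def]
      have : P.eps⁻¹ * (P.spacing k ^ 2 * (c₀ * Real.exp (-(δ₀ * (((P.L : ℝ) ^ k)⁻¹ * D'))) * (K / (R₀ - R₁) * F))) =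
          (P.eps⁻¹ * P.spacing k ^ 2) * (c₀ * (K / (R₀ - R₁)) * Real.exp (-(δ₀ * (((P.L : ℝ) ^ k)⁻¹ * D'))) * F) := by ring
      rw [this, hscale]; ring
    rw [e]
    refine mul_le_mul_of_nonneg_left ?_ hsp0.le
    have hcoef : c₀ * (K / (R₀ - R₁)) * (P.L : ℝ) ^ k ≤ C * ((P.L : ℝ) ^ k * (R₀ - R₁)⁻¹) := by
      have h5 : c₀ * (K / (R₀ - R₁)) ≤ C * (R₀ - R₁)⁻¹ := by
        calc c₀ * (K / (R₀ - R₁)) ≤ c₀ * (Λ₀ * (R₀ - R₁)⁻¹) := mul_le_mul_of_nonneg_left hKle hc₀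
          _ = (c₀ * Λ₀) * (R₀ - R₁)⁻¹ := by ring
          _ ≤ C * (R₀ - R₁)⁻¹ := mul_le_mul_of_nonneg_right (by linarith) (inv_pos.mpr hgap').le
      calc c₀ * (K / (R₀ - R₁)) * (P.L : ℝ) ^ k ≤ C * (R₀ - R₁)⁻¹ * (P.L : ℝ) ^ k := mul_le_mul_of_nonneg_right h5 hLk.le
        _ = C * ((P.L : ℝ) ^ k * (R₀ - R₁)⁻¹) := by ring
    calc c₀ * (K / (R₀ - R₁)) * (P.L : ℝ) ^ k * Real.exp (-(δ₀ * (((P.L : ℝ) ^ k)⁻¹ * D'))) * F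
        ≤ C * ((P.L : ℝ) ^ k * (R₀ - R₁)⁻¹) * (E * ER1) * F :=
          mul_le_mul_of_nonneg_right (mul_le_mul hcoef (hED' le_rfl) (Real.exp_pos _).le (by positivity)) hF0
      _ = C * ((P.L : ℝ) ^ k * (R₀ - R₁)⁻¹ * ER1) * E * F := by ring
  refine ((norm_add_le _ _).trans (add_le_add ((norm_add_le _ _).trans (add_le_add ((norm_add_le _ _).trans
    (add_le_add hsum1 hsum2)) hterm3)) hterm4)).trans ?_
  calc m * B₁ + P.eps⁻¹ * (2 * m * B₂) + B₃ + P.eps⁻¹ * B₄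
      ≤ P.spacing k * (C * (m * 1 * E2R) * E * F) + P.spacing k * (C * (m * ((P.L : ℝ) ^ k * ((R₀ - R₁)⁻¹ + (s : ℝ)⁻¹)) * E2R) * E * F) +
        P.spacing k * (C * (1 * ER1) * E * F) + P.spacing k * (C * ((P.L : ℝ) ^ k * (R₀ - R₁)⁻¹ * ER1) * E * F) :=
        add_le_add (add_le_add (add_le_add h1 h2) h3) h4
    _ = P.spacing k * (C * (m * (1 + (P.L : ℝ) ^ k * ((R₀ - R₁)⁻¹ + (s : ℝ)⁻¹)) * E2R + (1 + (P.L : ℝ) ^ k * (R₀ - R₁)⁻¹) * ER1) * E * F) := by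
        ring

/-! ## §2 The value member of (2.31) for a general region `Ω ⊇ Ω₀`, from (H2) and (H4) -/

set_option maxHeartbeats 400000 in
/-- **(2.31) FOR A GENERAL REGION `Ω ⊇ Ω₀`, OPERATOR FORM, PRINTED LOCALIZATION DATA, ARBITRARY `U(1)` FIELD, FROM THE TWO VALUE [6]-INPUTS
AS HYPOTHESES** (*"|(G_{k,loc}(u)f − G_k(Ω,u)f)(x)| ≦ e^{−cr(e_k)}e^{−c dist(suppt f,x)}‖f‖_∞, (2.31) for dist(x, Ω^c) ≧ O(r(e_k))"*).  As
`BIJ88LocHolder231TorusOfInputs.close231_wholeTorus_of_inputs` (the case `Ω = T^{(0)}`) with `G_k(T_η,u) ↦ G_k(Ω,u)`: (H2) for the fitting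
cubes `□ ⊆ Ω` at their `ρ`-deep rows, (H4) for `G_k(Ω,u)` at the `ρ`-deep rows of `Ω`; for every `x ∈ Ω₀` at chart depth `≥ R₀ + R`
(`R ≥ ρ`) and every `f` (`‖f‖_∞ ≤ F`) supported at sup-torus distance `≥ D ≥ 0` from `x`:
`|(G_{k,loc}(u)f)(x) − (G_k(Ω,u)f)(x)| ≤ (L^kε)²·c₀·[m·e^{−2δ₀R/L^k} + e^{−(δ₀/2)R₁/L^k}]·e^{−(δ₀/2)D/L^k}·F` — p31's `opClose231_gen` with
`X₀ = {x}`. [cite: BalabanImbrieJaffe1988, (2.31) p.263] [cite: Balaban1983RegularityDecay, Theorem p.573 (1.10)–(1.12)] -/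
theorem close231_region_of_inputs (d : ℕ) {c₀ : ℝ} (hc₀ : 0 ≤ c₀) :
    ∀ (P : Params) (hPd : P.d = d + 1) (a : ℝ) (k : ℕ), 1 ≤ k → k ≤ P.K →
      ∀ (U : GaugeField P 0 U1) (Ω : Finset (Balaban1983to89.Site P 0)) (δ₀ ρ : ℝ), 0 < δ₀ → 0 ≤ ρ →
      -- (H2) the (1.11)–(1.12) value closeness member for the fitting no-wrap cubes `□ ⊆ Ω`
      (∀ (c' M' : Fin (d + 1) → ℕ), (∀ i, 1 ≤ M' i) → (∀ i, c' i * P.L ^ k + P.L ^ k * M' i ≤ P.sitesPerDir 0) →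
          (∀ i, P.L ^ k * M' i < P.sitesPerDir 0) → (cubeT hPd (P.L ^ k) c' fun i => P.L ^ k * M' i) ⊆ Ω →
        ∀ (x : Balaban1983to89.Site P 0), x ∈ (cubeT hPd (P.L ^ k) c' fun i => P.L ^ k * M' i) →
          (∀ w, w ∉ (cubeT hPd (P.L ^ k) c' fun i => P.L ^ k * M' i) → ρ ≤ B5Ineq137Torus.T P 0 x w) →
        ∀ (g : Balaban1983to89.Site P 0 → ℂ) (F D Db Df : ℝ), (∀ y, ‖g y‖ ≤ F) →
          (∀ y, y ∉ (cubeT hPd (P.L ^ k) c' fun i => P.L ^ k * M' i) → g y = 0) →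
          0 ≤ D → (∀ y, g y ≠ 0 → D ≤ B5Ineq137Torus.T P 0 x y) →
          0 ≤ Db → (∀ w, w ∉ (cubeT hPd (P.L ^ k) c' fun i => P.L ^ k * M' i) → Db ≤ B5Ineq137Torus.T P 0 x w) →
          0 ≤ Df → (∀ y, g y ≠ 0 → ∀ w, w ∉ (cubeT hPd (P.L ^ k) c' fun i => P.L ^ k * M' i) → Df ≤ B5Ineq137Torus.T P 0 y w) →
          ‖(gBox (B1RG242Torus.α P a k * (P.L : ℝ) ^ (k * P.d)) P.eps⁻¹ U k (cubeT hPd (P.L ^ k) c' fun i => P.L ^ k * M' i) *ᵥ g) x -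
              (gBox (B1RG242Torus.α P a k * (P.L : ℝ) ^ (k * P.d)) P.eps⁻¹ U k Ω *ᵥ g) x‖ ≤
            P.spacing k ^ 2 * (c₀ * Real.exp (-(δ₀ * (((P.L : ℝ) ^ k)⁻¹ * D))) * Real.exp (-(δ₀ * (((P.L : ℝ) ^ k)⁻¹ * (Db + Df)))) * F)) →
      -- (H4) the (1.10) value member of `G_k(Ω,u)` at the `ρ`-deep rows of `Ω`
      (∀ (x : Balaban1983to89.Site P 0), x ∈ Ω → (∀ w, w ∉ Ω → ρ ≤ B5Ineq137Torus.T P 0 x w) →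
        ∀ (g : Balaban1983to89.Site P 0 → ℂ) (F D : ℝ), (∀ y, ‖g y‖ ≤ F) → 0 ≤ D →
          (∀ y, g y ≠ 0 → D ≤ B5Ineq137Torus.T P 0 x y) →
          ‖(gBox (B1RG242Torus.α P a k * (P.L : ℝ) ^ (k * P.d)) P.eps⁻¹ U k Ω *ᵥ g) x‖ ≤
            P.spacing k ^ 2 * (c₀ * Real.exp (-(δ₀ * (((P.L : ℝ) ^ k)⁻¹ * D))) * F)) →
      ∀ (c M0 : Fin (d + 1) → ℕ), (∀ i, 1 ≤ M0 i) →
        (∀ i, c i * P.L ^ k + P.L ^ k * M0 i ≤ P.sitesPerDir 0) → (∀ i, P.L ^ k * M0 i < P.sitesPerDir 0) →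
        (cubeT hPd (P.L ^ k) c fun i => P.L ^ k * M0 i) ⊆ Ω →
      ∀ (s W : ℕ), 1 ≤ s → ∀ (R R₀ R₁ : ℝ), ρ ≤ R → 0 ≤ R₁ → R₁ < R₀ → 2 * (s : ℝ) / 3 + R₀ / 2 + R ≤ W →
        (∀ i, ((P.L ^ k * M0 i : ℕ) : ℝ) + R ≤ P.sitesPerDir 0) →
      ∀ (x : Balaban1983to89.Site P 0), x ∈ (cubeT hPd (P.L ^ k) c fun i => P.L ^ k * M0 i) →
        (∀ i, R₀ + R ≤ (boxCoord hPd (P.L ^ k) c x i : ℝ) ∧ (boxCoord hPd (P.L ^ k) c x i : ℝ) + (R₀ + R) ≤ (P.L ^ k * M0 i : ℕ) - 1) →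
      ∀ (f : Balaban1983to89.Site P 0 → ℂ) (F D : ℝ), (∀ y, ‖f y‖ ≤ F) → 0 ≤ D → (∀ y, f y ≠ 0 → D ≤ B5Ineq137Torus.T P 0 x y) →
        ‖(gLocT (B1RG242Torus.α P a k * (P.L : ℝ) ^ (k * P.d)) P.eps⁻¹ U k
                (cubeFam hPd (P.L ^ k) c M0 s W) (lamFam hPd (P.L ^ k) c M0 s) (cutoff R₁ R₀ (B5Ineq137Torus.T P 0)) *ᵥ f) x -
            (gBox (B1RG242Torus.α P a k * (P.L : ℝ) ^ (k * P.d)) P.eps⁻¹ U k Ω *ᵥ f) x‖ ≤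
          P.spacing k ^ 2 * (c₀ * ((⌊(((P.L : ℝ) ^ k) - 1 + R₀) / s⌋₊ + 3) ^ (d + 1) * Real.exp (-(δ₀ * (((P.L : ℝ) ^ k)⁻¹ * (2 * R)))) +
              Real.exp (-(δ₀ / 2 * (((P.L : ℝ) ^ k)⁻¹ * R₁)))) *
            Real.exp (-(δ₀ / 2 * (((P.L : ℝ) ^ k)⁻¹ * D))) * F) := by
  intro P hPd a k _hk1 hkK U Ω δ₀ ρ hδ₀ hρ H2 H4 c M0 hM0 hfit0 hN0 hΩ s W hs R R₀ R₁ hρR hR₁ hR10 hW hgap x hx hdeep f F D hF hD hsupp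
  classical
  have hn : 1 ≤ P.L ^ k := Nat.one_le_pow _ _ P.L_pos
  have hk : 0 + k ≤ P.m + P.K := by omega
  have hR0 : 0 ≤ R := hρ.trans hρR
  have hR₀ : 0 ≤ R₀ := hR₁.trans hR10.le
  have hs0 : 0 < s := hs
  have hF0 : 0 ≤ F := (norm_nonneg _).trans (hF x)
  have hζ0 := cutoff_eq_zero_of_le (P := P) hR10
  have hdeep₀ := depth_mono hPd (show R₀ ≤ R₀ + R by linarith) hdeep
  have hxΩ : x ∈ Ω := hΩ hx
  have hρΩ : ∀ w, w ∉ Ω → ρ ≤ B5Ineq137Torus.T P 0 x w := fun w hw =>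
    (lt_T_of_not_mem hPd hfit0 (depth_mono hPd (show ρ ≤ R₀ + R by linarith) hdeep) (fun h => hw (hΩ h))).le
  set A : ℝ := B1RG242Torus.α P a k * (P.L : ℝ) ^ (k * P.d) with hAdef
  set ζ := cutoff R₁ R₀ (B5Ineq137Torus.T P 0) with hζdef
  set m : ℝ := ((⌊(((P.L : ℝ) ^ k) - 1 + R₀) / s⌋₊ : ℝ) + 3) ^ (d + 1) with hmdef
  -- the row sets of (H2): the `ρ`-deep rows of each cube
  set Xr : ↥(labels (P.L ^ k) M0 s) → Finset (Balaban1983to89.Site P 0) := fun α =>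
    (cubeFam hPd (P.L ^ k) c M0 s W α).filter fun z => ∀ w, w ∉ cubeFam hPd (P.L ^ k) c M0 s W α → ρ ≤ B5Ineq137Torus.T P 0 z w
    with hXrdef
  -- the active labels on the row of `x`
  set S : Finset ↥(labels (P.L ^ k) M0 s) :=
    (activeLabels hPd (P.L ^ k) c s R₀ (blkIter k x)).subtype fun α => α ∈ labels (P.L ^ k) M0 s with hSdef
  have hcardS : (S.card : ℝ) ≤ m := by
    have h1 := card_subtype_activeLabels_le (hPd := hPd) (c := c) (M0 := M0) hn hs0 hR₀ (blkIter k x)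
    have e : (((P.L ^ k : ℕ) : ℕ) : ℝ) = (P.L : ℝ) ^ k := by push_cast; rfl
    rw [hSdef, hmdef]; rw [e] at h1; exact h1
  have hS : ∀ (α : ↥(labels (P.L ^ k) M0 s)) (y : Balaban1983to89.Site P 0), ζ x y * lamFam hPd (P.L ^ k) c M0 s α x y ≠ 0 →
      f y ≠ 0 → α ∈ S := by
    intro α y hne _
    rw [hSdef, Finset.mem_subtype]
    exact mem_activeLabels_of_ne_zero_of_deep hk hs0 hfit0 hζ0 (mem_blockK.2 rfl) hdeep₀ hne
  have hGΩ : ∀ z ∈ ({x} : Finset (Balaban1983to89.Site P 0)), ∀ (g : Balaban1983to89.Site P 0 → ℂ) (F D : ℝ), (∀ y, ‖g y‖ ≤ F) →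
      0 ≤ D → (∀ y, g y ≠ 0 → D ≤ B5Ineq137Torus.T P 0 z y) →
      ‖(gBox A P.eps⁻¹ U k Ω *ᵥ g) z‖ ≤ P.spacing k ^ 2 * (c₀ * Real.exp (-(δ₀ * (((P.L : ℝ) ^ k)⁻¹ * D))) * F) := by
    intro z hz g F D hF hD hs
    rw [Finset.mem_singleton] at hz
    subst hz
    exact H4 z hxΩ hρΩ g F D hF hD hs
  have hC : ∀ α, ∀ z ∈ Xr α, ∀ (g : Balaban1983to89.Site P 0 → ℂ) (F D Db Df : ℝ), (∀ y, ‖g y‖ ≤ F) →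
      (∀ y, y ∉ cubeFam hPd (P.L ^ k) c M0 s W α → g y = 0) →
      0 ≤ D → (∀ y, g y ≠ 0 → D ≤ B5Ineq137Torus.T P 0 z y) → 0 ≤ Db →
      (∀ w, w ∉ cubeFam hPd (P.L ^ k) c M0 s W α → Db ≤ B5Ineq137Torus.T P 0 z w) →
      0 ≤ Df → (∀ y, g y ≠ 0 → ∀ w, w ∉ cubeFam hPd (P.L ^ k) c M0 s W α → Df ≤ B5Ineq137Torus.T P 0 y w) →
      ‖(gBox A P.eps⁻¹ U k (cubeFam hPd (P.L ^ k) c M0 s W α) *ᵥ g) z - (gBox A P.eps⁻¹ U k Ω *ᵥ g) z‖ ≤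
        P.spacing k ^ 2 * (c₀ * Real.exp (-(δ₀ * (((P.L : ℝ) ^ k)⁻¹ * D))) * Real.exp (-(δ₀ * (((P.L : ℝ) ^ k)⁻¹ * (Db + Df)))) * F) := by
    intro α z hz g F' D' Db Df hF' hsuppg hD' hsD' hDb hsDb hDf hsDf
    obtain ⟨c', M', hM', hfit', hN', hcα⟩ := cubeFam_fits (hPd := hPd) (n := P.L ^ k) (c := c) (s := s) (W := W) hM0 hfit0 hN0 α
    simp only [hXrdef, Finset.mem_filter] at hz
    obtain ⟨hz1, hz2⟩ := hz
    have hsubΩ : (cubeT hPd (P.L ^ k) c' fun i => P.L ^ k * M' i) ⊆ Ω := hcα ▸ (cubeOf_subset α.1).trans hΩ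
    rw [hcα] at hz1 hz2 hsuppg hsDb hsDf ⊢
    exact H2 c' M' hM' hfit' hN' hsubΩ z hz1 hz2 g F' D' Db Df hF' hsuppg hD' hsD' hDb hsDb hDf hsDf
  have hcomp : ∀ y, ζ x y ≠ 0 → ∑ α : ↥(labels (P.L ^ k) M0 s), lamFam hPd (P.L ^ k) c M0 s α x y = 1 :=
    rowHyp_i hPd hfit0 hζ0 hx hdeep₀
  have hdeepH : ∀ (α : ↥(labels (P.L ^ k) M0 s)) (y : Balaban1983to89.Site P 0), ζ x y * lamFam hPd (P.L ^ k) c M0 s α x y ≠ 0 →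
      x ∈ Xr α ∧ y ∈ cubeFam hPd (P.L ^ k) c M0 s W α ∧
        ∀ w, w ∉ cubeFam hPd (P.L ^ k) c M0 s W α → R ≤ B5Ineq137Torus.T P 0 x w ∧ R ≤ B5Ineq137Torus.T P 0 y w := by
    intro α y hne
    obtain ⟨hxα, hyα, hfar⟩ := rowHyp_ii_torus hPd hn hs0 hfit0 hR0 hR₀ hgap hW hζ0 hx hdeep α y hne
    refine ⟨?_, hyα, hfar⟩
    simp only [hXrdef, Finset.mem_filter]
    exact ⟨hxα, fun w hw => hρR.trans (hfar w hw).1⟩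
  have hcut : ∀ y, B5Ineq137Torus.T P 0 x y ≤ R₁ → ζ x y = 1 := rowHyp_iii hR10 x
  have hmain := opClose231_gen A P.eps⁻¹ U Ω {x} (cubeFam hPd (P.L ^ k) c M0 s W) Xr (sum_abs_lamT_le_one hfit0)
    (cutoff_mem_unitInterval R₁ R₀) hδ₀.le hc₀ hGΩ hC x (Finset.mem_singleton_self x) hR0 hcomp hdeepH hcut f hF hD hsupp S hS
  refine hmain.trans (mul_le_mul_of_nonneg_left ?_ (sq_nonneg _))
  refine mul_le_mul_of_nonneg_right (mul_le_mul_of_nonneg_right (mul_le_mul_of_nonneg_left ?_ hc₀) (Real.exp_pos _).le) hF0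
  exact add_le_add (mul_le_mul_of_nonneg_right hcardS (Real.exp_pos _).le) le_rfl

/-! ## §3 The Hölder member of order `θ ≤ 1` of (2.31) for a general region `Ω ⊇ Ω₀`, from (H1)–(H4) -/

set_option maxHeartbeats 400000 in
/-- **THE HÖLDER MEMBER OF ORDER `θ ≤ 1` OF (2.31) FOR A GENERAL REGION `Ω ⊇ Ω₀`, PRINTED LOCALIZATION DATA, ARBITRARY `U(1)` FIELD, FROM
THE FOUR [6]-INPUTS AS HYPOTHESES, ALONG EVERY ADMISSIBLE CONTOUR** (p. 263: *"… Hölder derivatives of G_{k,loc}(u) of order less than two"*).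
As `BIJ88LocHolder231TorusOfInputs.holder231_wholeTorus_of_inputs` (the case `Ω = T^{(0)}`) with `G_k(T_η,u) ↦ G_k(Ω,u)` and the hypotheses of
`deriv231_region_of_inputs`: for every `0 ≤ θ ≤ 1`, every pair `x₁, x₂` joined by an admissible bond chain `Γ`, every `f` supported at
sup-torus distance `≥ D` from both points, `ψ = G_{k,loc}(u)f − G_k(Ω,u)f`:
`(L^k/|x₁ − x₂|_T)^θ·‖u(Γ)ψ(x₂) − ψ(x₁)‖ ≤ (L^kε)²·C·e^{δ₀/2}·[m(1 + L^k((R₀−R₁)⁻¹ + s⁻¹))e^{−δ₀(2R−1)/L^k} + (1 + L^k(R₀−R₁)⁻¹)e^{−(δ₀/2)(R₁−1)/L^k}]·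
e^{−(δ₀/2)D/L^k}·F`, `C = (d+1)C₁ + 2c₀` — this gen's kernel `weighted_transport_sub_le` with §1 on the bonds of `Γ` and §2 at the end points.
[cite: BalabanImbrieJaffe1988, (2.31) p.263] [cite: Balaban1983RegularityDecay, Theorem p.573 (1.9)–(1.12)] -/
theorem holder231_region_of_inputs (d : ℕ) {c₀ : ℝ} (hc₀ : 0 ≤ c₀) :
    ∃ C : ℝ, 0 < C ∧ ∀ (P : Params) (hPd : P.d = d + 1) (a : ℝ) (k : ℕ), 1 ≤ k → k ≤ P.K →
      ∀ (U : GaugeField P 0 U1) (Ω : Finset (Balaban1983to89.Site P 0)) (δ₀ ρ : ℝ), 0 < δ₀ → 0 ≤ ρ →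
      -- (H1) the (1.11)–(1.12) covariant-derivative closeness member for the fitting no-wrap cubes `□ ⊆ Ω`
      (∀ (c' M' : Fin (d + 1) → ℕ), (∀ i, 1 ≤ M' i) → (∀ i, c' i * P.L ^ k + P.L ^ k * M' i ≤ P.sitesPerDir 0) →
          (∀ i, P.L ^ k * M' i < P.sitesPerDir 0) → (cubeT hPd (P.L ^ k) c' fun i => P.L ^ k * M' i) ⊆ Ω →
        ∀ (x : Balaban1983to89.Site P 0) (μ : Fin P.d), x ∈ (cubeT hPd (P.L ^ k) c' fun i => P.L ^ k * M' i) →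
          x.shift μ ∈ (cubeT hPd (P.L ^ k) c' fun i => P.L ^ k * M' i) →
          (∀ w, w ∉ (cubeT hPd (P.L ^ k) c' fun i => P.L ^ k * M' i) → ρ ≤ B5Ineq137Torus.T P 0 x w) →
        ∀ (g : Balaban1983to89.Site P 0 → ℂ) (F D Db Df : ℝ), (∀ y, ‖g y‖ ≤ F) →
          (∀ y, y ∉ (cubeT hPd (P.L ^ k) c' fun i => P.L ^ k * M' i) → g y = 0) →
          0 ≤ D → (∀ y, g y ≠ 0 → D ≤ B5Ineq137Torus.T P 0 x y) →
          0 ≤ Db → (∀ w, w ∉ (cubeT hPd (P.L ^ k) c' fun i => P.L ^ k * M' i) → Db ≤ B5Ineq137Torus.T P 0 x w) →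
          0 ≤ Df → (∀ y, g y ≠ 0 → ∀ w, w ∉ (cubeT hPd (P.L ^ k) c' fun i => P.L ^ k * M' i) → Df ≤ B5Ineq137Torus.T P 0 y w) →
          ‖covD P.eps⁻¹ (cfg U) (gBox (B1RG242Torus.α P a k * (P.L : ℝ) ^ (k * P.d)) P.eps⁻¹ U k
                  (cubeT hPd (P.L ^ k) c' fun i => P.L ^ k * M' i) *ᵥ g) ⟨x, μ⟩ -
              covD P.eps⁻¹ (cfg U) (gBox (B1RG242Torus.α P a k * (P.L : ℝ) ^ (k * P.d)) P.eps⁻¹ U k Ω *ᵥ g) ⟨x, μ⟩‖ ≤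
            P.spacing k * (c₀ * Real.exp (-(δ₀ * (((P.L : ℝ) ^ k)⁻¹ * D))) * Real.exp (-(δ₀ * (((P.L : ℝ) ^ k)⁻¹ * (Db + Df)))) * F)) →
      -- (H2) the (1.11)–(1.12) value closeness member for the same cubes and rows
      (∀ (c' M' : Fin (d + 1) → ℕ), (∀ i, 1 ≤ M' i) → (∀ i, c' i * P.L ^ k + P.L ^ k * M' i ≤ P.sitesPerDir 0) →
          (∀ i, P.L ^ k * M' i < P.sitesPerDir 0) → (cubeT hPd (P.L ^ k) c' fun i => P.L ^ k * M' i) ⊆ Ω →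
        ∀ (x : Balaban1983to89.Site P 0), x ∈ (cubeT hPd (P.L ^ k) c' fun i => P.L ^ k * M' i) →
          (∀ w, w ∉ (cubeT hPd (P.L ^ k) c' fun i => P.L ^ k * M' i) → ρ ≤ B5Ineq137Torus.T P 0 x w) →
        ∀ (g : Balaban1983to89.Site P 0 → ℂ) (F D Db Df : ℝ), (∀ y, ‖g y‖ ≤ F) →
          (∀ y, y ∉ (cubeT hPd (P.L ^ k) c' fun i => P.L ^ k * M' i) → g y = 0) →
          0 ≤ D → (∀ y, g y ≠ 0 → D ≤ B5Ineq137Torus.T P 0 x y) →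
          0 ≤ Db → (∀ w, w ∉ (cubeT hPd (P.L ^ k) c' fun i => P.L ^ k * M' i) → Db ≤ B5Ineq137Torus.T P 0 x w) →
          0 ≤ Df → (∀ y, g y ≠ 0 → ∀ w, w ∉ (cubeT hPd (P.L ^ k) c' fun i => P.L ^ k * M' i) → Df ≤ B5Ineq137Torus.T P 0 y w) →
          ‖(gBox (B1RG242Torus.α P a k * (P.L : ℝ) ^ (k * P.d)) P.eps⁻¹ U k (cubeT hPd (P.L ^ k) c' fun i => P.L ^ k * M' i) *ᵥ g) x -
              (gBox (B1RG242Torus.α P a k * (P.L : ℝ) ^ (k * P.d)) P.eps⁻¹ U k Ω *ᵥ g) x‖ ≤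
            P.spacing k ^ 2 * (c₀ * Real.exp (-(δ₀ * (((P.L : ℝ) ^ k)⁻¹ * D))) * Real.exp (-(δ₀ * (((P.L : ℝ) ^ k)⁻¹ * (Db + Df)))) * F)) →
      -- (H3) the (1.10) covariant-derivative member of `G_k(Ω,u)` at the `ρ`-deep rows of `Ω`
      (∀ (x : Balaban1983to89.Site P 0), x ∈ Ω → (∀ w, w ∉ Ω → ρ ≤ B5Ineq137Torus.T P 0 x w) →
        ∀ (μ : Fin P.d) (g : Balaban1983to89.Site P 0 → ℂ) (F D : ℝ), (∀ y, ‖g y‖ ≤ F) → 0 ≤ D →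
          (∀ y, g y ≠ 0 → D ≤ B5Ineq137Torus.T P 0 x y) →
          ‖covD P.eps⁻¹ (cfg U) (gBox (B1RG242Torus.α P a k * (P.L : ℝ) ^ (k * P.d)) P.eps⁻¹ U k Ω *ᵥ g) ⟨x, μ⟩‖ ≤
            P.spacing k * (c₀ * Real.exp (-(δ₀ * (((P.L : ℝ) ^ k)⁻¹ * D))) * F)) →
      -- (H4) the (1.10) value member of `G_k(Ω,u)` at the `ρ`-deep rows of `Ω`
      (∀ (x : Balaban1983to89.Site P 0), x ∈ Ω → (∀ w, w ∉ Ω → ρ ≤ B5Ineq137Torus.T P 0 x w) →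
        ∀ (g : Balaban1983to89.Site P 0 → ℂ) (F D : ℝ), (∀ y, ‖g y‖ ≤ F) → 0 ≤ D →
          (∀ y, g y ≠ 0 → D ≤ B5Ineq137Torus.T P 0 x y) →
          ‖(gBox (B1RG242Torus.α P a k * (P.L : ℝ) ^ (k * P.d)) P.eps⁻¹ U k Ω *ᵥ g) x‖ ≤
            P.spacing k ^ 2 * (c₀ * Real.exp (-(δ₀ * (((P.L : ℝ) ^ k)⁻¹ * D))) * F)) →
      ∀ (c M0 : Fin (d + 1) → ℕ), (∀ i, 1 ≤ M0 i) →
        (∀ i, c i * P.L ^ k + P.L ^ k * M0 i ≤ P.sitesPerDir 0) → (∀ i, P.L ^ k * M0 i < P.sitesPerDir 0) →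
        (cubeT hPd (P.L ^ k) c fun i => P.L ^ k * M0 i) ⊆ Ω →
      ∀ (s W : ℕ), 1 ≤ s → ∀ (R R₀ R₁ : ℝ), ρ + 1 < R → 0 ≤ R₁ → R₁ < R₀ → 2 * (s : ℝ) / 3 + R₀ / 2 + R ≤ W →
        (∀ i, ((P.L ^ k * M0 i : ℕ) : ℝ) + R ≤ P.sitesPerDir 0) →
      ∀ (θ : ℝ), 0 ≤ θ → θ ≤ 1 →
      ∀ (x₁ x₂ : Balaban1983to89.Site P 0) (n : ℕ) (sq : ℕ → Balaban1983to89.Site P 0) (cb : ℕ → PBond P 0),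
        sq 0 = x₁ → sq n = x₂ → (∀ m < n, Joins (cb m) (sq m) (sq (m + 1))) →
        (n : ℝ) ≤ ((d : ℝ) + 1) * B5Ineq137Torus.T P 0 x₁ x₂ →
        (∀ m ≤ n, sq m ∈ (cubeT hPd (P.L ^ k) c fun i => P.L ^ k * M0 i) ∧
          (∀ i, R₀ + R ≤ (boxCoord hPd (P.L ^ k) c (sq m) i : ℝ) ∧
            (boxCoord hPd (P.L ^ k) c (sq m) i : ℝ) + (R₀ + R) ≤ (P.L ^ k * M0 i : ℕ) - 1) ∧
          B5Ineq137Torus.T P 0 x₁ (sq m) ≤ B5Ineq137Torus.T P 0 x₁ x₂) →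
      ∀ (f : Balaban1983to89.Site P 0 → ℂ) (F D : ℝ), (∀ y, ‖f y‖ ≤ F) → 0 ≤ D →
        (∀ y, f y ≠ 0 → D ≤ B5Ineq137Torus.T P 0 x₁ y) → (∀ y, f y ≠ 0 → D ≤ B5Ineq137Torus.T P 0 x₂ y) →
        ((P.L : ℝ) ^ k / B5Ineq137Torus.T P 0 x₁ x₂) ^ θ *
          ‖toC (chainHol sq cb U n) *
              ((gLocT (B1RG242Torus.α P a k * (P.L : ℝ) ^ (k * P.d)) P.eps⁻¹ U k
                  (cubeFam hPd (P.L ^ k) c M0 s W) (lamFam hPd (P.L ^ k) c M0 s) (cutoff R₁ R₀ (B5Ineq137Torus.T P 0)) *ᵥ f) x₂ -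
                (gBox (B1RG242Torus.α P a k * (P.L : ℝ) ^ (k * P.d)) P.eps⁻¹ U k Ω *ᵥ f) x₂) -
            ((gLocT (B1RG242Torus.α P a k * (P.L : ℝ) ^ (k * P.d)) P.eps⁻¹ U k
                  (cubeFam hPd (P.L ^ k) c M0 s W) (lamFam hPd (P.L ^ k) c M0 s) (cutoff R₁ R₀ (B5Ineq137Torus.T P 0)) *ᵥ f) x₁ -
                (gBox (B1RG242Torus.α P a k * (P.L : ℝ) ^ (k * P.d)) P.eps⁻¹ U k Ω *ᵥ f) x₁)‖ ≤
          P.spacing k ^ 2 * (C * Real.exp (δ₀ / 2) *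
            ((⌊(((P.L : ℝ) ^ k) - 1 + R₀) / s⌋₊ + 3) ^ (d + 1) * (1 + (P.L : ℝ) ^ k * ((R₀ - R₁)⁻¹ + (s : ℝ)⁻¹)) *
              Real.exp (-(δ₀ * (((P.L : ℝ) ^ k)⁻¹ * (2 * R - 1)))) +
            (1 + (P.L : ℝ) ^ k * (R₀ - R₁)⁻¹) * Real.exp (-(δ₀ / 2 * (((P.L : ℝ) ^ k)⁻¹ * (R₁ - 1))))) *
            Real.exp (-(δ₀ / 2 * (((P.L : ℝ) ^ k)⁻¹ * D))) * F) := by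
  obtain ⟨C₁, hC₁, G1⟩ := deriv231_region_of_inputs d hc₀
  refine ⟨((d : ℝ) + 1) * C₁ + 2 * c₀, by positivity, ?_⟩
  intro P hPd a k hk1 hkK U Ω δ₀ ρ hδ₀ hρ H1 H2 H3 H4 c M0 hM0 hfit0 hN0 hΩ s W hs R R₀ R₁ hR hR₁ hR10 hW hgap θ hθ0 hθ1
    x₁ x₂ n sq cb hsq0 hsqn hJ hnle hchain f F D hF hD hsupp₁ hsupp₂
  have hρR : ρ ≤ R := by linarith
  have G2 := close231_region_of_inputs d hc₀ P hPd a k hk1 hkK U Ω δ₀ ρ hδ₀ hρ H2 H4 c M0 hM0 hfit0 hN0 hΩ s W hs R R₀ R₁ hρR hR₁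
    hR10 hW hgap
  replace G1 := G1 P hPd a k hk1 hkK U Ω δ₀ ρ hδ₀ hρ H1 H2 H3 H4 c M0 hM0 hfit0 hN0 hΩ s W hs R R₀ R₁ hR hR₁ hR10 hW hgap
  set C : ℝ := ((d : ℝ) + 1) * C₁ + 2 * c₀ with hCdef
  have hLpos : (0 : ℝ) < P.L := P.cast_L_pos
  have hLk : (0 : ℝ) < (P.L : ℝ) ^ k := pow_pos hLpos _
  have hLkinv : 0 < ((P.L : ℝ) ^ k)⁻¹ := inv_pos.mpr hLk
  have hF0 : 0 ≤ F := (norm_nonneg _).trans (hF x₁)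
  have hgap' : 0 < R₀ - R₁ := sub_pos.2 hR10
  have hsr : (0 : ℝ) < s := by exact_mod_cast hs
  have hT0 : 0 ≤ B5Ineq137Torus.T P 0 x₁ x₂ := B5Ineq137Torus.T_nonneg P 0 x₁ x₂
  -- the end points are chain sites
  obtain ⟨hx₁, hdeep₁, -⟩ := hsq0 ▸ hchain 0 (Nat.zero_le n)
  obtain ⟨hx₂, hdeep₂, -⟩ := hsqn ▸ hchain n le_rfl
  -- abbreviations
  set Aop : ℝ := B1RG242Torus.α P a k * (P.L : ℝ) ^ (k * P.d) with hAdef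
  set ζ := cutoff R₁ R₀ (B5Ineq137Torus.T P 0) with hζdef
  set ψL : Balaban1983to89.Site P 0 → ℂ := gLocT Aop P.eps⁻¹ U k (cubeFam hPd (P.L ^ k) c M0 s W) (lamFam hPd (P.L ^ k) c M0 s) ζ *ᵥ f
    with hψLdef
  set ψΩ : Balaban1983to89.Site P 0 → ℂ := gBox Aop P.eps⁻¹ U k Ω *ᵥ f with hψΩdef
  set ψ : Balaban1983to89.Site P 0 → ℂ := ψL - ψΩ with hψdef
  have hψ : ∀ x, ψL x - ψΩ x = ψ x := fun x => rfl
  set T12 : ℝ := B5Ineq137Torus.T P 0 x₁ x₂ with hT12def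
  set m : ℝ := ((⌊(((P.L : ℝ) ^ k) - 1 + R₀) / s⌋₊ : ℝ) + 3) ^ (d + 1) with hmdef
  have hm0 : 0 ≤ m := by rw [hmdef]; positivity
  set br : ℝ := 1 + (P.L : ℝ) ^ k * ((R₀ - R₁)⁻¹ + (s : ℝ)⁻¹) with hbrdef
  have hbr1 : 1 ≤ br := by rw [hbrdef]; exact le_add_of_nonneg_right (by positivity)
  have hbr0 : 0 ≤ br := zero_le_one.trans hbr1
  set br₁ : ℝ := 1 + (P.L : ℝ) ^ k * (R₀ - R₁)⁻¹ with hbr₁def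
  have hbr₁1 : 1 ≤ br₁ := by rw [hbr₁def]; exact le_add_of_nonneg_right (by positivity)
  have hbr₁0 : 0 ≤ br₁ := zero_le_one.trans hbr₁1
  set ER : ℝ := Real.exp (-(δ₀ * (((P.L : ℝ) ^ k)⁻¹ * (2 * R - 1)))) with hERdef
  set ER₁ : ℝ := Real.exp (-(δ₀ / 2 * (((P.L : ℝ) ^ k)⁻¹ * (R₁ - 1)))) with hER₁def
  set Ex : ℝ := Real.exp (-(δ₀ / 2 * (((P.L : ℝ) ^ k)⁻¹ * D))) with hEdef
  have hER0 : 0 < ER := Real.exp_pos _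
  have hER₁0 : 0 < ER₁ := Real.exp_pos _
  have hE0 : 0 < Ex := Real.exp_pos _
  set Br : ℝ := m * br * ER + br₁ * ER₁ with hBrdef
  have hBr0 : 0 ≤ Br := by positivity
  have he1 : 1 ≤ Real.exp (δ₀ / 2) := Real.one_le_exp (by positivity)
  -- the value member's exponentials are dominated by the derivative member's
  have hER_2 : Real.exp (-(δ₀ * (((P.L : ℝ) ^ k)⁻¹ * (2 * R)))) ≤ ER :=
    Real.exp_le_exp.2 (neg_le_neg (mul_le_mul_of_nonneg_left (mul_le_mul_of_nonneg_left (by linarith) hLkinv.le) hδ₀.le))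
  have hER₁_2 : Real.exp (-(δ₀ / 2 * (((P.L : ℝ) ^ k)⁻¹ * R₁))) ≤ ER₁ :=
    Real.exp_le_exp.2 (neg_le_neg (mul_le_mul_of_nonneg_left (mul_le_mul_of_nonneg_left (by linarith) hLkinv.le) (by positivity)))
  show ((P.L : ℝ) ^ k / T12) ^ θ * ‖toC (chainHol sq cb U n) * (ψL x₂ - ψΩ x₂) - (ψL x₁ - ψΩ x₁)‖ ≤ _
  rw [hψ, hψ]
  -- the target, factorised
  have hRHS : P.spacing k ^ 2 * (C * Real.exp (δ₀ / 2) * Br * Ex * F) =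
      P.spacing k ^ 2 * (C * Real.exp (δ₀ / 2) *
        ((⌊(((P.L : ℝ) ^ k) - 1 + R₀) / s⌋₊ + 3) ^ (d + 1) * (1 + (P.L : ℝ) ^ k * ((R₀ - R₁)⁻¹ + (s : ℝ)⁻¹)) *
          Real.exp (-(δ₀ * (((P.L : ℝ) ^ k)⁻¹ * (2 * R - 1)))) +
        (1 + (P.L : ℝ) ^ k * (R₀ - R₁)⁻¹) * Real.exp (-(δ₀ / 2 * (((P.L : ℝ) ^ k)⁻¹ * (R₁ - 1))))) *
        Real.exp (-(δ₀ / 2 * (((P.L : ℝ) ^ k)⁻¹ * D))) * F) := by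
    rw [hBrdef, hmdef, hbrdef, hbr₁def, hERdef, hER₁def, hEdef]
  rw [← hRHS]
  -- the two quantities of §1's kernel
  set X : ℝ := C₁ * Real.exp (δ₀ / 2) * Br * Ex * F with hXdef
  set Y : ℝ := c₀ * Br * Ex * F with hYdef
  have hX0 : 0 ≤ X := by positivity
  have hY0 : 0 ≤ Y := by positivity
  -- NEAR PAIRS: the derivative member on every bond of the contour
  have hbond : T12 ≤ (P.L : ℝ) ^ k → ∀ m' < n, ‖covD P.eps⁻¹ (cfg U) ψ (cb m')‖ ≤ P.spacing k * X := by
    intro hnear m' hm'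
    obtain ⟨hmem0, hdeep0, hclose0⟩ := hchain m' hm'.le
    obtain ⟨hmem1, hdeep1, hclose1⟩ := hchain (m' + 1) (Nat.succ_le_of_lt hm')
    have hb : cb m' = ⟨(cb m').src, (cb m').dir⟩ := rfl
    have htgt : (cb m').tgt = (cb m').src.shift (cb m').dir := rfl
    have hends : ((cb m').src ∈ (cubeT hPd (P.L ^ k) c fun i => P.L ^ k * M0 i) ∧
        (∀ i, R₀ + R ≤ (boxCoord hPd (P.L ^ k) c (cb m').src i : ℝ) ∧
          (boxCoord hPd (P.L ^ k) c (cb m').src i : ℝ) + (R₀ + R) ≤ (P.L ^ k * M0 i : ℕ) - 1) ∧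
        B5Ineq137Torus.T P 0 x₁ (cb m').src ≤ T12) ∧
        ((cb m').src.shift (cb m').dir ∈ (cubeT hPd (P.L ^ k) c fun i => P.L ^ k * M0 i) ∧
        (∀ i, R₀ + R ≤ (boxCoord hPd (P.L ^ k) c ((cb m').src.shift (cb m').dir) i : ℝ) ∧
          (boxCoord hPd (P.L ^ k) c ((cb m').src.shift (cb m').dir) i : ℝ) + (R₀ + R) ≤ (P.L ^ k * M0 i : ℕ) - 1)) := by
      rw [← htgt]
      rcases hJ m' hm' with ⟨h1, h2⟩ | ⟨h1, h2⟩
      · rw [h1, h2]; exact ⟨⟨hmem0, hdeep0, hclose0⟩, hmem1, hdeep1⟩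
      · rw [h1, h2]; exact ⟨⟨hmem1, hdeep1, hclose1⟩, hmem0, hdeep0⟩
    obtain ⟨⟨hzmem, hzdeep, hzclose⟩, hzemem, hzedeep⟩ := hends
    -- the support of `f` seen from the bond: `≥ D − T12`
    set D' : ℝ := max (D - T12) 0 with hD'def
    have hD'0 : 0 ≤ D' := le_max_right _ _
    have hD'supp : ∀ y, f y ≠ 0 → D' ≤ B5Ineq137Torus.T P 0 (cb m').src y := by
      intro y hy
      refine max_le ?_ (B5Ineq137Torus.T_nonneg P 0 _ y)
      have h1 := hsupp₁ y hy
      have h2 := B5Ineq137Torus.T_triangle P 0 x₁ (cb m').src y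
      linarith
    have hder := G1 (cb m').src (cb m').dir hzmem hzdeep hzemem hzedeep f F D' hF hD'0 hD'supp
    rw [← covD_sub, ← hb] at hder
    refine hder.trans (mul_le_mul_of_nonneg_left ?_ (P.spacing_pos k).le)
    -- the exponent: `D' ≥ D − T12 ≥ D − L^k`
    have hexpD' : Real.exp (-(δ₀ / 2 * (((P.L : ℝ) ^ k)⁻¹ * D'))) ≤ Real.exp (δ₀ / 2) * Ex := by
      have h1 : D - T12 ≤ D' := le_max_left _ _
      have h2 : ((P.L : ℝ) ^ k)⁻¹ * T12 ≤ 1 := by rw [inv_mul_le_iff₀ hLk, mul_one]; exact hnear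
      have h3 : -(δ₀ / 2 * (((P.L : ℝ) ^ k)⁻¹ * D')) ≤ δ₀ / 2 + -(δ₀ / 2 * (((P.L : ℝ) ^ k)⁻¹ * D)) := by
        have h4 : δ₀ / 2 * (((P.L : ℝ) ^ k)⁻¹ * (D - T12)) ≤ δ₀ / 2 * (((P.L : ℝ) ^ k)⁻¹ * D') :=
          mul_le_mul_of_nonneg_left (mul_le_mul_of_nonneg_left h1 hLkinv.le) (by positivity)
        have h6 : δ₀ / 2 * (((P.L : ℝ) ^ k)⁻¹ * T12) ≤ δ₀ / 2 * 1 := mul_le_mul_of_nonneg_left h2 (by positivity)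
        have h7 : δ₀ / 2 * (((P.L : ℝ) ^ k)⁻¹ * (D - T12)) =
            δ₀ / 2 * (((P.L : ℝ) ^ k)⁻¹ * D) - δ₀ / 2 * (((P.L : ℝ) ^ k)⁻¹ * T12) := by ring
        linarith
      calc Real.exp (-(δ₀ / 2 * (((P.L : ℝ) ^ k)⁻¹ * D'))) ≤ Real.exp (δ₀ / 2 + -(δ₀ / 2 * (((P.L : ℝ) ^ k)⁻¹ * D))) :=
            Real.exp_le_exp.2 h3
        _ = Real.exp (δ₀ / 2) * Ex := by rw [Real.exp_add]
    rw [hXdef]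
    calc C₁ * Br * Real.exp (-(δ₀ / 2 * (((P.L : ℝ) ^ k)⁻¹ * D'))) * F
        ≤ C₁ * Br * (Real.exp (δ₀ / 2) * Ex) * F :=
          mul_le_mul_of_nonneg_right (mul_le_mul_of_nonneg_left hexpD' (by positivity)) hF0
      _ = C₁ * Real.exp (δ₀ / 2) * Br * Ex * F := by ring
  -- FAR PAIRS: the value member at both end points
  have hval : (P.L : ℝ) ^ k < T12 → ‖ψ x₁‖ ≤ P.spacing k ^ 2 * Y ∧ ‖ψ x₂‖ ≤ P.spacing k ^ 2 * Y := by
    intro _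
    have hv : ∀ x : Balaban1983to89.Site P 0,
        ‖ψL x - ψΩ x‖ ≤ P.spacing k ^ 2 * (c₀ * (((⌊(((P.L : ℝ) ^ k) - 1 + R₀) / s⌋₊ : ℝ) + 3) ^ (d + 1) *
            Real.exp (-(δ₀ * (((P.L : ℝ) ^ k)⁻¹ * (2 * R)))) + Real.exp (-(δ₀ / 2 * (((P.L : ℝ) ^ k)⁻¹ * R₁)))) *
          Real.exp (-(δ₀ / 2 * (((P.L : ℝ) ^ k)⁻¹ * D))) * F) → ‖ψ x‖ ≤ P.spacing k ^ 2 * Y := by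
      intro x hx
      rw [← hψ]
      refine hx.trans (mul_le_mul_of_nonneg_left ?_ (sq_nonneg _))
      rw [hYdef, ← hmdef, ← hEdef]
      have hbr_le : m * Real.exp (-(δ₀ * (((P.L : ℝ) ^ k)⁻¹ * (2 * R)))) + Real.exp (-(δ₀ / 2 * (((P.L : ℝ) ^ k)⁻¹ * R₁))) ≤ Br := by
        rw [hBrdef]
        refine add_le_add ?_ ?_
        · calc m * Real.exp (-(δ₀ * (((P.L : ℝ) ^ k)⁻¹ * (2 * R)))) ≤ m * ER := mul_le_mul_of_nonneg_left hER_2 hm0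
            _ = m * 1 * ER := by ring
            _ ≤ m * br * ER := mul_le_mul_of_nonneg_right (mul_le_mul_of_nonneg_left hbr1 hm0) hER0.le
        · calc Real.exp (-(δ₀ / 2 * (((P.L : ℝ) ^ k)⁻¹ * R₁))) ≤ ER₁ := hER₁_2
            _ = 1 * ER₁ := (one_mul _).symm
            _ ≤ br₁ * ER₁ := mul_le_mul_of_nonneg_right hbr₁1 hER₁0.le
      exact mul_le_mul_of_nonneg_right (mul_le_mul_of_nonneg_right (mul_le_mul_of_nonneg_left hbr_le hc₀) hE0.le) hF0
    exact ⟨hv x₁ (G2 x₁ hx₁ hdeep₁ f F D hF hD hsupp₁), hv x₂ (G2 x₂ hx₂ hdeep₂ f F D hF hD hsupp₂)⟩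
  have key := weighted_transport_sub_le U ψ hθ0 hθ1 (by positivity : (0 : ℝ) ≤ (d : ℝ) + 1) hX0 hY0 hsq0 hsqn hJ hnle hbond hval
  refine key.trans (mul_le_mul_of_nonneg_left ?_ (sq_nonneg _))
  rw [hXdef, hYdef, hCdef]
  have h2 : 2 * (c₀ * Br * Ex * F) ≤ 2 * c₀ * Real.exp (δ₀ / 2) * Br * Ex * F := by
    have : c₀ * Br * Ex * F ≤ c₀ * Real.exp (δ₀ / 2) * Br * Ex * F := by
      have h0 : 0 ≤ c₀ * Br * Ex * F := by positivity
      calc c₀ * Br * Ex * F = 1 * (c₀ * Br * Ex * F) := (one_mul _).symm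
        _ ≤ Real.exp (δ₀ / 2) * (c₀ * Br * Ex * F) := mul_le_mul_of_nonneg_right he1 h0
        _ = c₀ * Real.exp (δ₀ / 2) * Br * Ex * F := by ring
    linarith
  calc ((d : ℝ) + 1) * (C₁ * Real.exp (δ₀ / 2) * Br * Ex * F) + 2 * (c₀ * Br * Ex * F)
      ≤ ((d : ℝ) + 1) * (C₁ * Real.exp (δ₀ / 2) * Br * Ex * F) + 2 * c₀ * Real.exp (δ₀ / 2) * Br * Ex * F := add_le_add le_rfl h2
    _ = (((d : ℝ) + 1) * C₁ + 2 * c₀) * Real.exp (δ₀ / 2) * Br * Ex * F := by ring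

/-! ## §4 The member along the chart staircase -/

/-- **THE HÖLDER MEMBER OF ORDER `θ ≤ 1` OF (2.31) FOR A GENERAL REGION `Ω ⊇ Ω₀`, ALONG THE CHART STAIRCASE**: with the constant of
`holder231_region_of_inputs`, for every pair `x₁, x₂ ∈ Ω₀` at chart depth `≥ R₀ + R` with `|x₁ − x₂|_T ≤ R₀ + R` THERE IS a bond chain of
`≤ (d+1)|x₁ − x₂|_T` steps (gen 28's `exists_admissible_contour`) along which §3's bound holds for every `θ` and `f`.
[cite: BalabanImbrieJaffe1988, (2.31) p.263] [cite: Balaban1983RegularityDecay, Theorem p.573 (1.9)] -/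
theorem exists_contour_holder231_region_of_inputs (d : ℕ) {c₀ : ℝ} (hc₀ : 0 ≤ c₀) :
    ∃ C : ℝ, 0 < C ∧ ∀ (P : Params) (hPd : P.d = d + 1) (a : ℝ) (k : ℕ), 1 ≤ k → k ≤ P.K →
      ∀ (U : GaugeField P 0 U1) (Ω : Finset (Balaban1983to89.Site P 0)) (δ₀ ρ : ℝ), 0 < δ₀ → 0 ≤ ρ →
      -- (H1) the (1.11)–(1.12) covariant-derivative closeness member for the fitting no-wrap cubes `□ ⊆ Ω`
      (∀ (c' M' : Fin (d + 1) → ℕ), (∀ i, 1 ≤ M' i) → (∀ i, c' i * P.L ^ k + P.L ^ k * M' i ≤ P.sitesPerDir 0) →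
          (∀ i, P.L ^ k * M' i < P.sitesPerDir 0) → (cubeT hPd (P.L ^ k) c' fun i => P.L ^ k * M' i) ⊆ Ω →
        ∀ (x : Balaban1983to89.Site P 0) (μ : Fin P.d), x ∈ (cubeT hPd (P.L ^ k) c' fun i => P.L ^ k * M' i) →
          x.shift μ ∈ (cubeT hPd (P.L ^ k) c' fun i => P.L ^ k * M' i) →
          (∀ w, w ∉ (cubeT hPd (P.L ^ k) c' fun i => P.L ^ k * M' i) → ρ ≤ B5Ineq137Torus.T P 0 x w) →
        ∀ (g : Balaban1983to89.Site P 0 → ℂ) (F D Db Df : ℝ), (∀ y, ‖g y‖ ≤ F) →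
          (∀ y, y ∉ (cubeT hPd (P.L ^ k) c' fun i => P.L ^ k * M' i) → g y = 0) →
          0 ≤ D → (∀ y, g y ≠ 0 → D ≤ B5Ineq137Torus.T P 0 x y) →
          0 ≤ Db → (∀ w, w ∉ (cubeT hPd (P.L ^ k) c' fun i => P.L ^ k * M' i) → Db ≤ B5Ineq137Torus.T P 0 x w) →
          0 ≤ Df → (∀ y, g y ≠ 0 → ∀ w, w ∉ (cubeT hPd (P.L ^ k) c' fun i => P.L ^ k * M' i) → Df ≤ B5Ineq137Torus.T P 0 y w) →
          ‖covD P.eps⁻¹ (cfg U) (gBox (B1RG242Torus.α P a k * (P.L : ℝ) ^ (k * P.d)) P.eps⁻¹ U k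
                  (cubeT hPd (P.L ^ k) c' fun i => P.L ^ k * M' i) *ᵥ g) ⟨x, μ⟩ -
              covD P.eps⁻¹ (cfg U) (gBox (B1RG242Torus.α P a k * (P.L : ℝ) ^ (k * P.d)) P.eps⁻¹ U k Ω *ᵥ g) ⟨x, μ⟩‖ ≤
            P.spacing k * (c₀ * Real.exp (-(δ₀ * (((P.L : ℝ) ^ k)⁻¹ * D))) * Real.exp (-(δ₀ * (((P.L : ℝ) ^ k)⁻¹ * (Db + Df)))) * F)) →
      -- (H2) the (1.11)–(1.12) value closeness member for the same cubes and rows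
      (∀ (c' M' : Fin (d + 1) → ℕ), (∀ i, 1 ≤ M' i) → (∀ i, c' i * P.L ^ k + P.L ^ k * M' i ≤ P.sitesPerDir 0) →
          (∀ i, P.L ^ k * M' i < P.sitesPerDir 0) → (cubeT hPd (P.L ^ k) c' fun i => P.L ^ k * M' i) ⊆ Ω →
        ∀ (x : Balaban1983to89.Site P 0), x ∈ (cubeT hPd (P.L ^ k) c' fun i => P.L ^ k * M' i) →
          (∀ w, w ∉ (cubeT hPd (P.L ^ k) c' fun i => P.L ^ k * M' i) → ρ ≤ B5Ineq137Torus.T P 0 x w) →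
        ∀ (g : Balaban1983to89.Site P 0 → ℂ) (F D Db Df : ℝ), (∀ y, ‖g y‖ ≤ F) →
          (∀ y, y ∉ (cubeT hPd (P.L ^ k) c' fun i => P.L ^ k * M' i) → g y = 0) →
          0 ≤ D → (∀ y, g y ≠ 0 → D ≤ B5Ineq137Torus.T P 0 x y) →
          0 ≤ Db → (∀ w, w ∉ (cubeT hPd (P.L ^ k) c' fun i => P.L ^ k * M' i) → Db ≤ B5Ineq137Torus.T P 0 x w) →
          0 ≤ Df → (∀ y, g y ≠ 0 → ∀ w, w ∉ (cubeT hPd (P.L ^ k) c' fun i => P.L ^ k * M' i) → Df ≤ B5Ineq137Torus.T P 0 y w) →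
          ‖(gBox (B1RG242Torus.α P a k * (P.L : ℝ) ^ (k * P.d)) P.eps⁻¹ U k (cubeT hPd (P.L ^ k) c' fun i => P.L ^ k * M' i) *ᵥ g) x -
              (gBox (B1RG242Torus.α P a k * (P.L : ℝ) ^ (k * P.d)) P.eps⁻¹ U k Ω *ᵥ g) x‖ ≤
            P.spacing k ^ 2 * (c₀ * Real.exp (-(δ₀ * (((P.L : ℝ) ^ k)⁻¹ * D))) * Real.exp (-(δ₀ * (((P.L : ℝ) ^ k)⁻¹ * (Db + Df)))) * F)) →
      -- (H3) the (1.10) covariant-derivative member of `G_k(Ω,u)` at the `ρ`-deep rows of `Ω`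
      (∀ (x : Balaban1983to89.Site P 0), x ∈ Ω → (∀ w, w ∉ Ω → ρ ≤ B5Ineq137Torus.T P 0 x w) →
        ∀ (μ : Fin P.d) (g : Balaban1983to89.Site P 0 → ℂ) (F D : ℝ), (∀ y, ‖g y‖ ≤ F) → 0 ≤ D →
          (∀ y, g y ≠ 0 → D ≤ B5Ineq137Torus.T P 0 x y) →
          ‖covD P.eps⁻¹ (cfg U) (gBox (B1RG242Torus.α P a k * (P.L : ℝ) ^ (k * P.d)) P.eps⁻¹ U k Ω *ᵥ g) ⟨x, μ⟩‖ ≤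
            P.spacing k * (c₀ * Real.exp (-(δ₀ * (((P.L : ℝ) ^ k)⁻¹ * D))) * F)) →
      -- (H4) the (1.10) value member of `G_k(Ω,u)` at the `ρ`-deep rows of `Ω`
      (∀ (x : Balaban1983to89.Site P 0), x ∈ Ω → (∀ w, w ∉ Ω → ρ ≤ B5Ineq137Torus.T P 0 x w) →
        ∀ (g : Balaban1983to89.Site P 0 → ℂ) (F D : ℝ), (∀ y, ‖g y‖ ≤ F) → 0 ≤ D →
          (∀ y, g y ≠ 0 → D ≤ B5Ineq137Torus.T P 0 x y) →
          ‖(gBox (B1RG242Torus.α P a k * (P.L : ℝ) ^ (k * P.d)) P.eps⁻¹ U k Ω *ᵥ g) x‖ ≤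
            P.spacing k ^ 2 * (c₀ * Real.exp (-(δ₀ * (((P.L : ℝ) ^ k)⁻¹ * D))) * F)) →
      ∀ (c M0 : Fin (d + 1) → ℕ), (∀ i, 1 ≤ M0 i) →
        (∀ i, c i * P.L ^ k + P.L ^ k * M0 i ≤ P.sitesPerDir 0) → (∀ i, P.L ^ k * M0 i < P.sitesPerDir 0) →
        (cubeT hPd (P.L ^ k) c fun i => P.L ^ k * M0 i) ⊆ Ω →
      ∀ (s W : ℕ), 1 ≤ s → ∀ (R R₀ R₁ : ℝ), ρ + 1 < R → 0 ≤ R₁ → R₁ < R₀ → 2 * (s : ℝ) / 3 + R₀ / 2 + R ≤ W →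
        (∀ i, ((P.L ^ k * M0 i : ℕ) : ℝ) + R ≤ P.sitesPerDir 0) →
      ∀ (x₁ x₂ : Balaban1983to89.Site P 0),
        x₁ ∈ (cubeT hPd (P.L ^ k) c fun i => P.L ^ k * M0 i) →
        (∀ i, R₀ + R ≤ (boxCoord hPd (P.L ^ k) c x₁ i : ℝ) ∧ (boxCoord hPd (P.L ^ k) c x₁ i : ℝ) + (R₀ + R) ≤ (P.L ^ k * M0 i : ℕ) - 1) →
        x₂ ∈ (cubeT hPd (P.L ^ k) c fun i => P.L ^ k * M0 i) →
        (∀ i, R₀ + R ≤ (boxCoord hPd (P.L ^ k) c x₂ i : ℝ) ∧ (boxCoord hPd (P.L ^ k) c x₂ i : ℝ) + (R₀ + R) ≤ (P.L ^ k * M0 i : ℕ) - 1) →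
        B5Ineq137Torus.T P 0 x₁ x₂ ≤ R₀ + R →
      ∃ (N : ℕ) (sq : ℕ → Balaban1983to89.Site P 0) (cb : ℕ → PBond P 0), sq 0 = x₁ ∧ sq N = x₂ ∧
        (∀ m < N, Joins (cb m) (sq m) (sq (m + 1))) ∧ (N : ℝ) ≤ ((d : ℝ) + 1) * B5Ineq137Torus.T P 0 x₁ x₂ ∧
      ∀ (θ : ℝ), 0 ≤ θ → θ ≤ 1 →
      ∀ (f : Balaban1983to89.Site P 0 → ℂ) (F D : ℝ), (∀ y, ‖f y‖ ≤ F) → 0 ≤ D →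
        (∀ y, f y ≠ 0 → D ≤ B5Ineq137Torus.T P 0 x₁ y) → (∀ y, f y ≠ 0 → D ≤ B5Ineq137Torus.T P 0 x₂ y) →
        ((P.L : ℝ) ^ k / B5Ineq137Torus.T P 0 x₁ x₂) ^ θ *
          ‖toC (chainHol sq cb U N) *
              ((gLocT (B1RG242Torus.α P a k * (P.L : ℝ) ^ (k * P.d)) P.eps⁻¹ U k
                  (cubeFam hPd (P.L ^ k) c M0 s W) (lamFam hPd (P.L ^ k) c M0 s) (cutoff R₁ R₀ (B5Ineq137Torus.T P 0)) *ᵥ f) x₂ -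
                (gBox (B1RG242Torus.α P a k * (P.L : ℝ) ^ (k * P.d)) P.eps⁻¹ U k Ω *ᵥ f) x₂) -
            ((gLocT (B1RG242Torus.α P a k * (P.L : ℝ) ^ (k * P.d)) P.eps⁻¹ U k
                  (cubeFam hPd (P.L ^ k) c M0 s W) (lamFam hPd (P.L ^ k) c M0 s) (cutoff R₁ R₀ (B5Ineq137Torus.T P 0)) *ᵥ f) x₁ -
                (gBox (B1RG242Torus.α P a k * (P.L : ℝ) ^ (k * P.d)) P.eps⁻¹ U k Ω *ᵥ f) x₁)‖ ≤
          P.spacing k ^ 2 * (C * Real.exp (δ₀ / 2) *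
            ((⌊(((P.L : ℝ) ^ k) - 1 + R₀) / s⌋₊ + 3) ^ (d + 1) * (1 + (P.L : ℝ) ^ k * ((R₀ - R₁)⁻¹ + (s : ℝ)⁻¹)) *
              Real.exp (-(δ₀ * (((P.L : ℝ) ^ k)⁻¹ * (2 * R - 1)))) +
            (1 + (P.L : ℝ) ^ k * (R₀ - R₁)⁻¹) * Real.exp (-(δ₀ / 2 * (((P.L : ℝ) ^ k)⁻¹ * (R₁ - 1))))) *
            Real.exp (-(δ₀ / 2 * (((P.L : ℝ) ^ k)⁻¹ * D))) * F) := by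
  obtain ⟨C, hC, G⟩ := holder231_region_of_inputs d hc₀
  refine ⟨C, hC, ?_⟩
  intro P hPd a k hk1 hkK U Ω δ₀ ρ hδ₀ hρ H1 H2 H3 H4 c M0 hM0 hfit0 hN0 hΩ s W hs R R₀ R₁ hR hR₁ hR10 hW hgap x₁ x₂ hx₁ hdeep₁ hx₂
    hdeep₂ hT
  obtain ⟨N, sq, cb, h0, hN, hJ, hNle, hchain⟩ := exists_admissible_contour hPd hfit0 hx₁ hdeep₁ hx₂ hdeep₂ hT
  refine ⟨N, sq, cb, h0, hN, hJ, hNle, fun θ hθ0 hθ1 f F D hF hD hD₁ hD₂ => ?_⟩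
  have hchain' : ∀ m ≤ N, sq m ∈ (cubeT hPd (P.L ^ k) c fun i => P.L ^ k * M0 i) ∧
      (∀ i, R₀ + R ≤ (boxCoord hPd (P.L ^ k) c (sq m) i : ℝ) ∧ (boxCoord hPd (P.L ^ k) c (sq m) i : ℝ) + (R₀ + R) ≤ (P.L ^ k * M0 i : ℕ) - 1) ∧
      B5Ineq137Torus.T P 0 x₁ (sq m) ≤ B5Ineq137Torus.T P 0 x₁ x₂ := fun m hm => by
    obtain ⟨h1, h2, h3⟩ := hchain m hm
    exact ⟨h1, fun i => by simpa only [min_self] using h2 i, h3⟩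
  exact G P hPd a k hk1 hkK U Ω δ₀ ρ hδ₀ hρ H1 H2 H3 H4 c M0 hM0 hfit0 hN0 hΩ s W hs R R₀ R₁ hR hR₁ hR10 hW hgap θ hθ0 hθ1 x₁ x₂ N sq cb
    h0 hN hJ hNle hchain' f F D hF hD hD₁ hD₂

end

end Literature.MathematicalPhysics.QuantumFieldTheory.BalabanImbrieJaffe1984to88.BIJ88Loc231RegionOfInputs
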